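import Mathlib.Analysis.InnerProductSpace.PiL2
import Mathlib.Analysis.InnerProductSpace.Projection.Basic
import Literature.MathematicalPhysics.QuantumFieldTheory.Balaban1983to89.MatrixNorms
import Literature.MathematicalPhysics.QuantumFieldTheory.Balaban1983to89.B12RegularSpaces111ClosedSubgroup
import Literature.MathematicalPhysics.QuantumFieldTheory.Balaban1983to89.B12Lemma4Models
import Literature.MathematicalPhysics.QuantumFieldTheory.Balaban1983to89.B12CondIIIJConcrete

/-!
# `Balaban1983to89.B12Eq18Projection` — T. Bałaban, *Renormalization group approach to lattice gauge field theories. I*,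
Commun. Math. Phys. **109** (1987) 249–301 [Balaban1987RG1]: **the projection `π` of (1.8) onto `𝐠ᶜ`, CONSTRUCTED for every closed
`G ≤ U(N)`**, with its two printed-context properties PROVED — values in `𝐠ᶜ` and `π ∘ Ad(g) = Ad(g) ∘ π` for EVERY `g ∈ Gᶜ` — the
(20)-bound `|πX| ≤ √N|X|`, `π(X*) = (πX)*`, agreement with the lineage's two hand-made cases (`U(N)`: `π = id`; `SU(N)`: p07's traceless
part `slProj`), and the corollaries for the current `J(𝐔) = D^{ξ*}_𝐔 ξ⁻²π Im ∂𝐔`: gauge covariance (1.10) for every `Gᶜ`-valued `u`,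
`𝐠ᶜ`-values, Lemma 4 (3.53) / (1.17) membership of the printed pair — all hypothesis-free on gen 16's `closedSubgroupModel G`; v1.1 adds
the (iv)-from-(3.38) / J-half Lemma-4 chain with `Gᶜ`-valued `u_j` (§7) and [15] (3.117) `D*J = 0` for the `π`-current (§8).

HONEST FRAMING (cell `lit-balaban`, verbatim): statement-level skeleton of published theorems with citation tags; proofs where landed; nothing here is a claim about the Yang–Mills mass gap.

PDFs held and read (text layer + page renders): `paper:balaban1987-cmp109-rg-i-small-field` p. 261 [p0013 L32] (1.8); [12] =
[Balaban1985Averaging] `paper:balaban1985-cmp98-averaging` §A pp. 20–21 [p0004–p0005] (17)–(20) (render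
`b2b-balaban-ref1/pages/1985-cmp98-averaging/…-p005-x2.png` re-read as an image by this seat: (20) reads `|tr X| ≤ |X|, ‖X‖ ≤ |X|,
|X| ≤ √N‖X‖, |XY| ≤ |X||Y|, ‖XY‖ ≤ ‖X‖‖Y‖` with the NORMALIZED trace `tr 1 = 1`); [15] = [Balaban1985BackgroundPropagators]
`paper:balaban1985-cmp99-background-propagators` pp. 391–392 [p0003–p0004] (3.7), (3.11)–(3.12).

THE PRINT, verbatim.  [I] p. 261: *«From the previous papers it is clear that it appears only in the functions
J_j = D^{ξ*}_{U_j} ξ⁻² π Im ∂U_j, (1.8) where π denotes the projection in the space of all complex N × N-matrices onto the algebra 𝐠ᶜ,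
and Im U = (1/2i)(U − U⁻¹).»*  [I] p. 262: *«A Gᶜ-valued gauge transformation u acts on pairs (𝐔, 𝐉) in the following way
(𝐔, 𝐉)^u = (𝐔^u, R(u)𝐉) = (u₋𝐔u₊⁻¹, R(u₋)𝐉), (1.10)»*.  [12] §A p. 20: *«We consider a Lie subgroup G of a unitary group U(N). Its Lie
algebra g is a subalgebra of the algebra of hermitian matrices. … The complexification gᶜ is a subalgebra of the algebra of all complex
matrices. … We introduce a scalar product in the algebra of all complex matrices»* (17) `⟨X, Y⟩ = tr X*Y`, p. 21: *«for a matrix X the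
norm is given by ‖X‖² = tr X*X … the operator norm |X| = sup |Xψ| (19) … |tr X| ≤ |X|, ‖X‖ ≤ |X|, |X| ≤ √N ‖X‖ (20)»*.  [15] p. 392:
*«Let us write the linear term in (3.7) as ⟨A, J⟩ = Σ η^d tr A(b)J(b), (3.11) where J = D*η⁻² Im ∂U»* — the current is the representer of
the linear term of the action for the scalar product (17) on `𝐠`-valued `A`; with «π … the projection … onto the algebra 𝐠ᶜ» of (1.8)
this is the ORTHOGONAL projection for (17), which is what this file constructs (for `G = SU(N)` it is the traceless part, p07's reading
`B12Lemma4Models.slProj`; for `G = U(N)` the identity, p07's `B12Eq18Current.current_id_eq_J` — both recovered in §5).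

WHAT THE LINEAGE HAD.  p07's `B12Eq18Current` (row B12.Eq1.8) types (1.8) with `π` as DATA — *«a ℂ-linear map 𝔸 →ₗ[ℂ] 𝔸 (DATA: the
printed projection onto 𝔤ᶜ; its two printed-context properties — commuting with the adjoint action of the gauge group, values in 𝔤ᶜ —
are the hypotheses hπ of the theorems that need them)»*; `B12Lemma4Models` / `B12Lemma4CondIVModels` / `B12CondIIIJConcreteModels`
discharge them in TWO hand-made models only (`U(N)`: `π = id`; `SU(N)`: `π = slProj`).  Print's standing case is «G … a Lie subgroup of
… U(N)», semisimple ([I] p. 252): gen 16's `B12RegularSpaces111ClosedSubgroup.closedSubgroupModel G hG` (every closed `G ≤ U(N)`, on p24's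
`Gᶜ = complexifiedGroup G`, `𝐠ᶜ = lieC G`) had no `π`.

WHAT THIS FILE PROVES (every closed `G ≤ U(N)`; `𝐠ᶜ = lieC G hG`, `Gᶜ = complexifiedGroup G`).
§1 `toE : M_N(ℂ) ≃ₗ[ℂ] ℂ^{N×N}` with `⟪toE X, toE Y⟫ = tr X*Y` (`inner_toE`: Mathlib's inner product IS (17)), `‖toE X‖² = Σ|X_ij|²`.
§2 **`proj G hG : M_N(ℂ) →ₗ[ℂ] M_N(ℂ)`** = the (17)-orthogonal projection onto `𝐠ᶜ` (Mathlib `Submodule.starProjection` in the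
   coordinates `toE`): `proj_mem` (values in `𝐠ᶜ`), `proj_eq_self_of_mem`/`_iff`, `proj_proj`, orthogonality `tr Z*(X − πX) = 0`
   (`trace_conjTranspose_mul_sub_proj`, also as `MatrixNorms.nhsInner`), UNIQUENESS `proj_eq_of_mem_of_orthogonal`, `proj_eq_zero_iff`.
§3 **`proj_conj` / `proj_R`: `π(gXg⁻¹) = gπ(X)g⁻¹` for ALL `g ∈ Gᶜ`** — the hypothesis `hπ` of `B12Eq18Current.current_gaugeU`.  Proof:
   the (17)-orthogonal complement of `𝐠ᶜ` is `Ad(G)`-stable (`orthogonal_conj_of_mem`: `Ad(u)` is a (17)-isometry for unitary `u` and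
   `𝐠ᶜ` is `Ad(G)`-stable, gen 16 `conj_mem_lieC`), hence `Ad(Gᶜ)`-stable by the CHEVALLEY-HULL ARGUMENT
   (`orthogonal_conj_of_mem_complexifiedGroup`): for fixed `Z ∈ 𝐠ᶜ`, `D ⊥ 𝐠ᶜ`, the function `g ↦ tr Z*·gDg⁻¹` is a polynomial in `g`,
   `g⁻¹` (`trace_mul_conj_mem_polyFun`, p24's `polyFun`) vanishing on `G`, hence on `Gᶜ = V(I(G))` (p24's `mem_complexifiedGroup_iff`,
   [BrockerTomDieck1985] III (8.2)); then uniqueness.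
§3b `proj_conjTranspose`: `π(X*) = (πX)*` (`𝐠ᶜ` and its complement are `*`-closed); hence `π(𝔲(N)) ⊆ 𝐠`
   (`proj_mem_lieSubalgebra_of_star_eq_neg`) and, in print's Hermitian convention, `i·π(X) ∈ 𝐠` for Hermitian `X`.
§4 (20): `π` contracts the `L²` norm (`sum_norm_sq_proj_le`, `nhsNorm_proj_le`) and **`|πX| ≤ √N|X|`** in the operator norm (19)
   (`norm_proj_le`, from the tree's `MatrixNorms` (20) lemmas) — the constant `Cπ = √N` of `B12CondIIIJConcrete`'s `hπn`.
§5 AGREEMENT: `proj_top : π_{U(N)} = id`; **`proj_specialUnitary : π_{SU(N)} = B12Lemma4Models.slProj N`** (traceless part).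
§6 COROLLARIES on `closedSubgroupModel G hG`, hypothesis-free: `closedSubgroupModel_hπ` / `_heGc` / `_hgc_Gc` (the three schema
   hypotheses of `B12Lemma4Space` / `B12Eq117Concrete`); **`current_gaugeU_closed`**, `current_gaugeU_eq_adJ_closed`,
   **`ofBackground_gaugeU_closed`** ((1.9) intertwines (1.10) for EVERY `Gᶜ`-valued `u`); **`current_mem_lieC`** («𝐉 … has values in
   𝐠ᶜ»); `norm_current_lt_alpha0_closed` (the `J`-budget ladder with `Cπ = √N`); **`ofBackground_mem_space'_lemma4_closed`** (Lemma 4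
   (3.53) membership of the printed pair `(𝐔, J(𝐔))`), `gaugeU_ofBackground_mem_space'_lemma4_closed` (its `Gᶜ`-gauge transform,
   print's `(exp iξ𝐇_j)^{u_j}` of (3.37)), `ofBackground_mem_space'_of_prop9Shape_closed` (the (1.17) specialisation).
§7 (v1.1) **(iv) DERIVED from (3.38) and the J-half DERIVED, printed `π`, every closed `G ≤ U(N)`**: p07's
   `B12Lemma4CondIV.ofBackground_mem_space'_lemma4_of_eq338` / `B12CondIIIJConcrete.ofBackground_mem_space'_lemma4_of_jInputs` need
   `hπR : ∀ g : 𝔸ˣ, π(gXg⁻¹) = gπ(X)g⁻¹` for ALL of `GL(N, ℂ)` — true for `id`/`slProj`, NOT for the printed `π` of a general `G`; here it is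
   REPLACED by the print-faithful «`u_j` ((3.37)) and `w₁` are `Gᶜ`-valued» (`mul_inv_apply_mem_complexifiedGroup` + §3 `proj_R`):
   `condIV_lemma4_of_eq338_closed`, `condIV_one_of_eq338_closed`, **`ofBackground_mem_space'_lemma4_of_eq338_closed`**,
   **`ofBackground_mem_space'_lemma4_of_jInputs_closed`** (`Cπ = √N`); `ofBackground_gaugeU_mem_space_iff_closed` (membership of the
   printed pair decided on the `Gᶜ`-orbit).
§8 (v1.1) **[15] (3.117) «D*J = 0» for the (1.8) current WITH the printed `π`** (`divB_current_eq_zero_closed`: every closed `G ≤ U(N)`,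
   every `Gᶜ`-valued `𝐔` on the torus of record; p07's «NOT here: D^{ξ*}J = 0 with π» item — `B9Eq3117Current.divB_divP_eq_zero` with its
   `Ad(∂𝐔(p))`-invariance input supplied by §3 `proj_R`; the `π = id` case is `B9TorusCalculus.divB_J_eq_zero`).

HONEST SCOPE / READING NOTES.  (a) Print does not say along which complement «the projection … onto the algebra 𝐠ᶜ» is taken; the
orthogonal one for print's own scalar product (17) is the reading forced by [15] (3.11)–(3.12) (the current as the representer of the
linear term) and it reproduces both hand-made cases of the lineage (§5); for semisimple `𝐠ᶜ` it is also the unique `Ad(G)`-equivariant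
projection whenever the trivial representation does not occur in the complement — not needed, not formalised.  (b) `|·|` is Mathlib's
`L²`-operator norm (scope `Matrix.Norms.L2Operator`) = (19); `‖·‖` of [12] is `MatrixNorms.nhsNorm` (normalized); the `√N` of §4 is
print's (20), not an artefact.  (c) Nothing of [I] is asserted beyond what p07's schemas prove: the §6 corollaries have exactly the
by-reference inputs of `B12Lemma4Space` / `B12Eq117Concrete` / `B12CondIIIJConcrete` ((3.37), (3.41), (3.45), (3.50), (iv), (1.17),
Prop. 9 [15]) as hypotheses; rows served (cells only, NO head change): B12.Eq1.8 (display owner r09, carrier p07), B12.Lem4 / B12.Eq1.17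
(model-instance cells), B12.Def§0 (owner r20: the `π` object of record for general `G`).  Three definitions with bodies (`toE`, `gcE`,
`proj`), one instance (`completeSpace_gcE`), private plumbing `MPoly*`; no `Prop` placeholder, no new fact; axioms standard.  Unit
`lit-balaban-r20` (reader/typer r20 gen 17; TAKING line HOME/STATUS.md 2026-08-22T07:11:34Z), HOME `run/shared/lean/pub/lit-balaban/`.
-/

noncomputable section

namespace Literature.MathematicalPhysics.QuantumFieldTheory.Balaban1983to89.B12Eq18Projection

open Literature.MathematicalPhysics.QuantumFieldTheory.Balaban1983to89
open Literature.Algebra.Lie.CompactGroupAlgebraic (UN)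
open Literature.Algebra.Lie.MatrixAlgebraicHull (polyFun entry_mem_polyFun invEntry_mem_polyFun)
open Literature.MathematicalPhysics.QuantumFieldTheory.Balaban1983to89.B12LieComplexification (lieSubalgebra lieC)
open Literature.MathematicalPhysics.QuantumFieldTheory.Balaban1983to89.B12ComplexifiedGroup (complexifiedGroup
  mem_complexifiedGroup_iff toUnits_mem_complexifiedGroup map_le_complexifiedGroup)
open Literature.MathematicalPhysics.QuantumFieldTheory.Balaban1983to89.B12RegularSpaces111ClosedSubgroup (conj_mem_lieC)
open scoped InnerProductSpace ComplexConjugate Matrix BigOperators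

variable {n : Type*}

-- the Lie-ring structure `⁅X, Y⁆ = XY − YX` on `M_N(ℂ)` used by `B12LieComplexification.lieC` (same idiom as p24's files)
attribute [local instance 100] LieRing.ofAssociativeRing

/-! ## §1. Bałaban's matrix scalar product (17) `⟨X, Y⟩ = tr X*Y` as Hilbert-space coordinates on `M_N(ℂ)` -/

section Coordinates

/-- **Hilbert–Schmidt coordinates**: `M_N(ℂ)` read as the Euclidean space `ℂ^{N×N}`, so that Mathlib's inner product is
Bałaban's matrix scalar product (17) `⟨X, Y⟩ = tr X*Y` (unnormalized trace; the normalization `tr 1 = 1` of [12] does not change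
orthogonality) — `inner_toE`. [cite: Balaban1985Averaging, (17) p.20] -/
def toE : Matrix n n ℂ ≃ₗ[ℂ] EuclideanSpace ℂ (n × n) where
  toFun X := WithLp.toLp 2 fun p : n × n => X p.1 p.2
  invFun v := Matrix.of fun i j => v (i, j)
  map_add' X Y := by ext p; simp
  map_smul' c X := by ext p; simp
  left_inv X := by ext i j; simp
  right_inv v := by ext p; simp

/-- Coordinates of `toE X`. [cite: Balaban1985Averaging, (17) p.20] -/
@[simp] theorem toE_apply (X : Matrix n n ℂ) (p : n × n) : toE X p = X p.1 p.2 := rfl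

/-- Entries of `toE.symm v`. [cite: Balaban1985Averaging, (17) p.20] -/
@[simp] theorem toE_symm_apply (v : EuclideanSpace ℂ (n × n)) (i j : n) :
    (toE.symm v : Matrix n n ℂ) i j = v (i, j) := rfl

variable [Fintype n]

/-- **The inner product in HS coordinates IS (17)**: `⟨toE X, toE Y⟩ = tr X*Y`. [cite: Balaban1985Averaging, (17) p.20] -/
theorem inner_toE (X Y : Matrix n n ℂ) : ⟪toE X, toE Y⟫_ℂ = (Xᴴ * Y).trace := by
  rw [PiLp.inner_apply, Fintype.sum_prod_type, Matrix.trace]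
  simp only [toE_apply, Matrix.diag_apply, Matrix.mul_apply, Matrix.conjTranspose_apply, RCLike.inner_apply,
    Complex.star_def]
  rw [Finset.sum_comm]
  exact Finset.sum_congr rfl fun j _ => Finset.sum_congr rfl fun i _ => mul_comm _ _

/-- **The norm in HS coordinates IS the `L²` norm of [12] p. 21** (unnormalized): `‖toE X‖² = Σ_{ij} |X_{ij}|² = Tr X*X`.
[cite: Balaban1985Averaging, (17) p.20] -/
theorem norm_toE_sq (X : Matrix n n ℂ) : ‖toE X‖ ^ 2 = ∑ i, ∑ j, ‖X i j‖ ^ 2 := by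
  rw [EuclideanSpace.norm_sq_eq, Fintype.sum_prod_type]
  rfl

end Coordinates

/-! ## §2. The printed projection `π` onto `𝐠ᶜ` for every closed `G ≤ U(N)` -/

section Projection

variable [Fintype n] [DecidableEq n] (G : Subgroup (UN n)) (hG : IsClosed (G : Set (UN n)))

/-- `𝐠ᶜ` (p24's `lieC G`) in HS coordinates. [cite: Balaban1987RG1, (1.8) p.261] -/
def gcE : Submodule ℂ (EuclideanSpace ℂ (n × n)) :=
  (lieC G hG).toSubmodule.map ((toE : Matrix n n ℂ ≃ₗ[ℂ] EuclideanSpace ℂ (n × n)) :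
    Matrix n n ℂ →ₗ[ℂ] EuclideanSpace ℂ (n × n))

/-- Membership in `gcE`: `v ∈ gcE ↔ toE⁻¹ v ∈ 𝐠ᶜ`. [cite: Balaban1987RG1, (1.8) p.261] -/
theorem mem_gcE_iff {v : EuclideanSpace ℂ (n × n)} : v ∈ gcE G hG ↔ (toE.symm v : Matrix n n ℂ) ∈ lieC G hG :=
  Submodule.mem_map_equiv (e := (toE : Matrix n n ℂ ≃ₗ[ℂ] EuclideanSpace ℂ (n × n))) _

/-- `toE X ∈ gcE ↔ X ∈ 𝐠ᶜ`. [cite: Balaban1987RG1, (1.8) p.261] -/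
theorem toE_mem_gcE_iff {X : Matrix n n ℂ} : toE X ∈ gcE G hG ↔ X ∈ lieC G hG := by
  rw [mem_gcE_iff, LinearEquiv.symm_apply_apply]

/-- `gcE` is complete (finite-dimensional), so it has an orthogonal projection. [cite: Balaban1987RG1, (1.8) p.261] -/
instance completeSpace_gcE : CompleteSpace (gcE G hG) :=
  FiniteDimensional.complete ℂ (gcE G hG)

/-- **THE PROJECTION `π` OF (1.8)** — «π denotes the projection in the space of all complex N × N-matrices onto the algebra 𝐠ᶜ» —
for EVERY closed `G ≤ U(N)`: the orthogonal projection, for Bałaban's scalar product (17) `⟨X, Y⟩ = tr X*Y`, of `M_N(ℂ)` onto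
`𝐠ᶜ = lieC G` (a `ℂ`-linear map; in [15] the current is introduced through the linear term `⟨A, J⟩` of the action, (3.11)–(3.12),
i.e. as the representer for this scalar product). [cite: Balaban1987RG1, (1.8) p.261] -/
def proj : Matrix n n ℂ →ₗ[ℂ] Matrix n n ℂ :=
  ((toE : Matrix n n ℂ ≃ₗ[ℂ] EuclideanSpace ℂ (n × n)).symm : EuclideanSpace ℂ (n × n) →ₗ[ℂ] Matrix n n ℂ) ∘ₗ
    (((gcE G hG).starProjection : EuclideanSpace ℂ (n × n) →L[ℂ] EuclideanSpace ℂ (n × n)) :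
      EuclideanSpace ℂ (n × n) →ₗ[ℂ] EuclideanSpace ℂ (n × n)) ∘ₗ
    ((toE : Matrix n n ℂ ≃ₗ[ℂ] EuclideanSpace ℂ (n × n)) : Matrix n n ℂ →ₗ[ℂ] EuclideanSpace ℂ (n × n))

/-- `π` in HS coordinates is Mathlib's orthogonal projection onto `gcE`. [cite: Balaban1987RG1, (1.8) p.261] -/
theorem toE_proj (X : Matrix n n ℂ) : toE (proj G hG X) = (gcE G hG).starProjection (toE X) := by
  simp [proj]

/-- **`π` takes values in `𝐠ᶜ`** (the hypothesis `hπ` of `B12Eq18Current.current_mem_gc`, `B12Lemma4Space`, `B12Eq117Concrete`).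
[cite: Balaban1987RG1, (1.8) p.261] -/
theorem proj_mem (X : Matrix n n ℂ) : proj G hG X ∈ lieC G hG := by
  rw [← toE_mem_gcE_iff G hG, toE_proj]
  exact Submodule.starProjection_apply_mem _ _

/-- **`π` is the identity on `𝐠ᶜ`.** [cite: Balaban1987RG1, (1.8) p.261] -/
theorem proj_eq_self_of_mem {X : Matrix n n ℂ} (hX : X ∈ lieC G hG) : proj G hG X = X := by
  apply (toE : Matrix n n ℂ ≃ₗ[ℂ] EuclideanSpace ℂ (n × n)).injective
  rw [toE_proj]
  exact Submodule.starProjection_eq_self_iff.2 ((toE_mem_gcE_iff G hG).2 hX)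

/-- `π X = X ↔ X ∈ 𝐠ᶜ`. [cite: Balaban1987RG1, (1.8) p.261] -/
theorem proj_eq_self_iff {X : Matrix n n ℂ} : proj G hG X = X ↔ X ∈ lieC G hG :=
  ⟨fun h => h ▸ proj_mem G hG X, proj_eq_self_of_mem G hG⟩

/-- `π ∘ π = π`. [cite: Balaban1987RG1, (1.8) p.261] -/
theorem proj_proj (X : Matrix n n ℂ) : proj G hG (proj G hG X) = proj G hG X :=
  proj_eq_self_of_mem G hG (proj_mem G hG X)

/-- **Orthogonality**: `X − πX ⊥ 𝐠ᶜ` for (17), i.e. `tr Z*(X − πX) = 0` for all `Z ∈ 𝐠ᶜ`. [cite: Balaban1987RG1, (1.8) p.261] -/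
theorem trace_conjTranspose_mul_sub_proj {Z : Matrix n n ℂ} (hZ : Z ∈ lieC G hG) (X : Matrix n n ℂ) :
    (Zᴴ * (X - proj G hG X)).trace = 0 := by
  rw [← inner_toE, map_sub, toE_proj, ← inner_conj_symm, Submodule.starProjection_inner_eq_zero _ _
    ((toE_mem_gcE_iff G hG).2 hZ), map_zero]

/-- Orthogonality, conjugate form: `tr (X − πX)*Z = 0` for all `Z ∈ 𝐠ᶜ`. [cite: Balaban1987RG1, (1.8) p.261] -/
theorem trace_conjTranspose_sub_proj_mul {Z : Matrix n n ℂ} (hZ : Z ∈ lieC G hG) (X : Matrix n n ℂ) :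
    ((X - proj G hG X)ᴴ * Z).trace = 0 := by
  rw [← inner_toE, map_sub, toE_proj, Submodule.starProjection_inner_eq_zero _ _ ((toE_mem_gcE_iff G hG).2 hZ)]

/-- In the letters of [12] (17): `⟨Z, X − πX⟩ = 0` for the normalized scalar product `MatrixNorms.nhsInner`.
[cite: Balaban1985Averaging, (17) p.20] -/
theorem nhsInner_sub_proj {Z : Matrix n n ℂ} (hZ : Z ∈ lieC G hG) (X : Matrix n n ℂ) :
    MatrixNorms.nhsInner Z (X - proj G hG X) = 0 := by
  rw [MatrixNorms.nhsInner, MatrixNorms.ntr, trace_conjTranspose_mul_sub_proj G hG hZ, zero_div]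

/-- **Uniqueness**: `π X` is THE element `Y ∈ 𝐠ᶜ` with `X − Y ⊥ 𝐠ᶜ`. [cite: Balaban1987RG1, (1.8) p.261] -/
theorem proj_eq_of_mem_of_orthogonal {X Y : Matrix n n ℂ} (hY : Y ∈ lieC G hG)
    (h : ∀ Z ∈ lieC G hG, (Zᴴ * (X - Y)).trace = 0) : proj G hG X = Y := by
  apply (toE : Matrix n n ℂ ≃ₗ[ℂ] EuclideanSpace ℂ (n × n)).injective
  rw [toE_proj]
  refine Submodule.eq_starProjection_of_mem_of_inner_eq_zero ((toE_mem_gcE_iff G hG).2 hY) fun w hw => ?_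
  have hw' := (mem_gcE_iff G hG).1 hw
  rw [← map_sub, ← (toE : Matrix n n ℂ ≃ₗ[ℂ] EuclideanSpace ℂ (n × n)).apply_symm_apply w, inner_toE]
  have hT : (X - Y)ᴴ * (toE.symm w : Matrix n n ℂ) = (((toE.symm w : Matrix n n ℂ))ᴴ * (X - Y))ᴴ := by
    rw [Matrix.conjTranspose_mul, Matrix.conjTranspose_conjTranspose]
  rw [hT, Matrix.trace_conjTranspose, h _ hw', star_zero]

/-- `π 0 = 0`, `π` of a sum, etc. are `map_zero`/`map_add`; recorded: `π` vanishes exactly on the (17)-orthogonal complement of `𝐠ᶜ`.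
[cite: Balaban1987RG1, (1.8) p.261] -/
theorem proj_eq_zero_iff {X : Matrix n n ℂ} : proj G hG X = 0 ↔ ∀ Z ∈ lieC G hG, (Zᴴ * X).trace = 0 := by
  constructor
  · intro h Z hZ
    simpa [h] using trace_conjTranspose_mul_sub_proj G hG hZ X
  · intro h
    exact proj_eq_of_mem_of_orthogonal G hG (lieC G hG).zero_mem (by simpa using h)

end Projection

/-! ## §3. `π` commutes with the adjoint action of the WHOLE complexified group: `π(gXg⁻¹) = gπ(X)g⁻¹`, `g ∈ Gᶜ` -/

section Equivariance

variable [Fintype n] [DecidableEq n]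

/-- Entrywise-polynomial (in `g`, `g⁻¹`) matrix-valued functions on `GL(N, ℂ)`: every entry lies in the coordinate algebra
`ℂ[g_{ij}, (g⁻¹)_{ij}]` of [BrockerTomDieck1985] III (8.2) (p24's `polyFun`) — plumbing for the Chevalley-hull argument.
[cite: BrockerTomDieck1985, III (8.2) p.152] -/
private def MPoly (F : (Matrix n n ℂ)ˣ → Matrix n n ℂ) : Prop :=
  ∀ i j, (fun g => F g i j) ∈ polyFun n

/-- Constant matrix functions are entrywise polynomial (constants lie in the coordinate algebra). [cite: BrockerTomDieck1985, III (8.2) p.152] -/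
private theorem MPoly.const (A : Matrix n n ℂ) : MPoly (fun _ : (Matrix n n ℂ)ˣ => A) := fun i j => by
  have h : (fun _ : (Matrix n n ℂ)ˣ => A i j) = algebraMap ℂ ((Matrix n n ℂ)ˣ → ℂ) (A i j) := by
    funext g
    simp [Pi.algebraMap_apply]
  rw [h]
  exact Subalgebra.algebraMap_mem _ _

/-- `g ↦ g` is entrywise polynomial (the generators `g_{ij}`). [cite: BrockerTomDieck1985, III (8.2) p.152] -/
private theorem MPoly.val : MPoly (fun g : (Matrix n n ℂ)ˣ => (g : Matrix n n ℂ)) := fun i j => entry_mem_polyFun i j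

/-- `g ↦ g⁻¹` is entrywise polynomial (the generators `(g⁻¹)_{ij}`). [cite: BrockerTomDieck1985, III (8.2) p.152] -/
private theorem MPoly.inv : MPoly (fun g : (Matrix n n ℂ)ˣ => ((g⁻¹ : (Matrix n n ℂ)ˣ) : Matrix n n ℂ)) :=
  fun i j => invEntry_mem_polyFun i j

/-- Products of entrywise-polynomial matrix functions are entrywise polynomial (the coordinate algebra is an algebra).
[cite: BrockerTomDieck1985, III (8.2) p.152] -/
private theorem MPoly.mul {F H : (Matrix n n ℂ)ˣ → Matrix n n ℂ} (hF : MPoly F) (hH : MPoly H) :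
    MPoly (fun g => F g * H g) := fun i j => by
  have h : (fun g => (F g * H g) i j) = ∑ k, ((fun g => F g i k) * fun g => H g k j) := by
    funext g
    simp only [Matrix.mul_apply, Finset.sum_apply, Pi.mul_apply]
  rw [h]
  exact Subalgebra.sum_mem _ fun k _ => Subalgebra.mul_mem _ (hF i k) (hH k j)

/-- The trace of an entrywise-polynomial matrix function is a polynomial function. [cite: BrockerTomDieck1985, III (8.2) p.152] -/
private theorem MPoly.trace {F : (Matrix n n ℂ)ˣ → Matrix n n ℂ} (hF : MPoly F) :
    (fun g => (F g).trace) ∈ polyFun n := by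
  have h : (fun g => (F g).trace) = ∑ i, fun g => F g i i := by
    funext g
    simp only [Matrix.trace, Matrix.diag_apply, Finset.sum_apply]
  rw [h]
  exact Subalgebra.sum_mem _ fun i _ => hF i i

/-- `g ↦ tr(A · gDg⁻¹)` is a polynomial function on `GL(N, ℂ)` in the sense of [BrockerTomDieck1985] III (8.2) (p24's `polyFun`).
[cite: BrockerTomDieck1985, III (8.2) p.152] -/
theorem trace_mul_conj_mem_polyFun (A D : Matrix n n ℂ) :
    (fun g : (Matrix n n ℂ)ˣ => (A * ((g : Matrix n n ℂ) * D * ((g⁻¹ : (Matrix n n ℂ)ˣ) : Matrix n n ℂ))).trace) ∈ polyFun n :=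
  MPoly.trace (MPoly.mul (MPoly.const A) (MPoly.mul (MPoly.mul MPoly.val (MPoly.const D)) MPoly.inv))

variable (G : Subgroup (UN n)) (hG : IsClosed (G : Set (UN n)))

/-- **The (17)-orthogonal complement of `𝐠ᶜ` is `Ad(G)`-stable**: for `u ∈ G` and `D ⊥ 𝐠ᶜ`, `uDu* ⊥ 𝐠ᶜ` — because `Ad(u)` is an
isometry of (17) (`u` unitary) and `𝐠ᶜ` is `Ad(G)`-stable («The spaces … are, by the definition, gauge invariant», [I] p. 263; tree
`conj_mem_lieC`). [cite: Balaban1987RG1, (1.8) p.261, (1.10) p.262] -/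
theorem orthogonal_conj_of_mem {D : Matrix n n ℂ} (hD : ∀ Z ∈ lieC G hG, (Zᴴ * D).trace = 0) {u : UN n} (hu : u ∈ G) :
    ∀ Z ∈ lieC G hG, (Zᴴ * ((u : Matrix n n ℂ) * D * star (u : Matrix n n ℂ))).trace = 0 := by
  intro Z hZ
  -- `u* Z u = Ad(u⁻¹) Z ∈ 𝐠ᶜ`
  have hZ' : star (u : Matrix n n ℂ) * Z * (u : Matrix n n ℂ) ∈ lieC G hG := by
    have h := conj_mem_lieC G hG (toUnits_mem_complexifiedGroup G (G.inv_mem hu)) hZ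
    rw [map_inv, inv_inv, Unitary.val_inv_toUnits_apply, Unitary.val_toUnits_apply, ← Unitary.star_eq_inv,
      Unitary.coe_star] at h
    exact h
  -- `tr Z*(u D u*) = tr (u* Z u)* D`
  have hcyc : (Zᴴ * ((u : Matrix n n ℂ) * D * star (u : Matrix n n ℂ))).trace =
      ((star (u : Matrix n n ℂ) * Z * (u : Matrix n n ℂ))ᴴ * D).trace := by
    rw [Matrix.conjTranspose_mul, Matrix.conjTranspose_mul, Matrix.star_eq_conjTranspose, Matrix.conjTranspose_conjTranspose,
      show Zᴴ * ((u : Matrix n n ℂ) * D * (u : Matrix n n ℂ)ᴴ) = (Zᴴ * (u : Matrix n n ℂ) * D) * (u : Matrix n n ℂ)ᴴ by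
        simp only [Matrix.mul_assoc],
      Matrix.trace_mul_comm, ← Matrix.mul_assoc, ← Matrix.mul_assoc]
  rw [hcyc]
  exact hD _ hZ'

/-- **The (17)-orthogonal complement of `𝐠ᶜ` is `Ad(Gᶜ)`-stable**: for EVERY `g ∈ Gᶜ = complexifiedGroup G` and `D ⊥ 𝐠ᶜ`,
`gDg⁻¹ ⊥ 𝐠ᶜ`.  Chevalley-hull argument ([BrockerTomDieck1985] III (8.2), p24's `mem_complexifiedGroup_iff`): for fixed `Z ∈ 𝐠ᶜ` the
function `g ↦ tr Z*·gDg⁻¹` is a polynomial in `g`, `g⁻¹` vanishing on `G` (previous lemma), hence on `Gᶜ = V(I(G))`.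
[cite: Balaban1987RG1, (1.8) p.261, (1.10) p.262; BrockerTomDieck1985, III (8.2) p.152] -/
theorem orthogonal_conj_of_mem_complexifiedGroup {D : Matrix n n ℂ} (hD : ∀ Z ∈ lieC G hG, (Zᴴ * D).trace = 0)
    {g : (Matrix n n ℂ)ˣ} (hg : g ∈ complexifiedGroup G) :
    ∀ Z ∈ lieC G hG, (Zᴴ * ((g : Matrix n n ℂ) * D * ((g⁻¹ : (Matrix n n ℂ)ˣ) : Matrix n n ℂ))).trace = 0 := by
  intro Z hZ
  refine (mem_complexifiedGroup_iff G).1 hg _ (trace_mul_conj_mem_polyFun Zᴴ D) fun u hu => ?_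
  show (Zᴴ * (((Unitary.toUnits u : (Matrix n n ℂ)ˣ) : Matrix n n ℂ) * D *
    (((Unitary.toUnits u)⁻¹ : (Matrix n n ℂ)ˣ) : Matrix n n ℂ))).trace = 0
  rw [Unitary.val_inv_toUnits_apply, Unitary.val_toUnits_apply, ← Unitary.star_eq_inv, Unitary.coe_star]
  exact orthogonal_conj_of_mem G hG hD hu Z hZ

/-- **`π` COMMUTES WITH THE ADJOINT ACTION OF `Gᶜ`**: `π(gXg⁻¹) = g π(X) g⁻¹` for every `g ∈ Gᶜ = complexifiedGroup G` — the
hypothesis `hπ : ∀ x X, π (R (u x) X) = R (u x) (π X)` of `B12Eq18Current.current_gaugeU` / `ofBackground_gaugeU` for every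
`Gᶜ`-valued gauge transformation `u`, DISCHARGED for every closed `G ≤ U(N)` («A Gᶜ-valued gauge transformation u acts on pairs
(𝐔, 𝐉) … (𝐔, 𝐉)^u = (𝐔^u, R(u)𝐉)», p. 262). [cite: Balaban1987RG1, (1.8) p.261, (1.10) p.262] -/
theorem proj_conj {g : (Matrix n n ℂ)ˣ} (hg : g ∈ complexifiedGroup G) (X : Matrix n n ℂ) :
    proj G hG ((g : Matrix n n ℂ) * X * ((g⁻¹ : (Matrix n n ℂ)ˣ) : Matrix n n ℂ)) =
      (g : Matrix n n ℂ) * proj G hG X * ((g⁻¹ : (Matrix n n ℂ)ˣ) : Matrix n n ℂ) := by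
  refine proj_eq_of_mem_of_orthogonal G hG (conj_mem_lieC G hG hg (proj_mem G hG X)) fun Z hZ => ?_
  have hsplit : (g : Matrix n n ℂ) * X * ((g⁻¹ : (Matrix n n ℂ)ˣ) : Matrix n n ℂ) -
      (g : Matrix n n ℂ) * proj G hG X * ((g⁻¹ : (Matrix n n ℂ)ˣ) : Matrix n n ℂ) =
      (g : Matrix n n ℂ) * (X - proj G hG X) * ((g⁻¹ : (Matrix n n ℂ)ˣ) : Matrix n n ℂ) := by
    rw [Matrix.mul_sub, Matrix.sub_mul]
  rw [hsplit]
  exact orthogonal_conj_of_mem_complexifiedGroup G hG (fun W hW => trace_conjTranspose_mul_sub_proj G hG hW X) hg Z hZ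

/-- The same in the letters of the tree's adjoint action `B9Eq39Adjoint.R g X = gXg⁻¹`. [cite: Balaban1987RG1, (1.10) p.262] -/
theorem proj_R {g : (Matrix n n ℂ)ˣ} (hg : g ∈ complexifiedGroup G) (X : Matrix n n ℂ) :
    proj G hG (B9Eq39Adjoint.R g X) = B9Eq39Adjoint.R g (proj G hG X) :=
  proj_conj G hG hg X

/-- In particular for `u ∈ G` (`G ≤ Gᶜ`): `π(uXu⁻¹) = uπ(X)u⁻¹`. [cite: Balaban1987RG1, (1.10) p.262] -/
theorem proj_R_of_mem_G {u : UN n} (hu : u ∈ G) (X : Matrix n n ℂ) :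
    proj G hG (B9Eq39Adjoint.R (Unitary.toUnits u) X) = B9Eq39Adjoint.R (Unitary.toUnits u) (proj G hG X) :=
  proj_R G hG (toUnits_mem_complexifiedGroup G hu) X

end Equivariance

/-! ## §3b. `π` commutes with `X ↦ X*`; on `𝔲(N)` it lands in the real Lie algebra `𝐠` -/

section Star

open Literature.Algebra.Lie.MatrixAlgebraicHull (star_mem_lieHull)
open Literature.MathematicalPhysics.QuantumFieldTheory.Balaban1983to89.B12ComplexifiedGroup (mem_lieHull_iff_mem_lieC
  coe_mem_unitaryGroup_of_mem_map mem_lieSubalgebra_of_mem_lieHull lieC_le_lieHull)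

variable [Fintype n] [DecidableEq n] (G : Subgroup (UN n)) (hG : IsClosed (G : Set (UN n)))

/-- `𝐠ᶜ` is closed under `X ↦ X*` (`𝐠 ⊆ 𝔲(N)`: `(A + iB)* = −A + iB`; p24's `star_mem_lieHull` + `Lie(Gᶜ) = 𝐠ᶜ`).
[cite: Balaban1987RG1, §0 p.252; Balaban1985Averaging, §A p.20] -/
theorem conjTranspose_mem_lieC {Z : Matrix n n ℂ} (hZ : Z ∈ lieC G hG) : Zᴴ ∈ lieC G hG := by
  have hS : ∀ s ∈ G.map (Unitary.toUnits : UN n →* (Matrix n n ℂ)ˣ), (s : Matrix n n ℂ) ∈ Matrix.unitaryGroup n ℂ :=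
    fun _ hs => coe_mem_unitaryGroup_of_mem_map G hs
  rw [← mem_lieHull_iff_mem_lieC G hG] at hZ ⊢
  rw [← Matrix.star_eq_conjTranspose]
  exact star_mem_lieHull hS hZ

/-- The (17)-orthogonal complement of `𝐠ᶜ` is closed under `X ↦ X*`. [cite: Balaban1985Averaging, (17) p.20; Balaban1987RG1, (1.8) p.261] -/
theorem orthogonal_conjTranspose {D : Matrix n n ℂ} (hD : ∀ Z ∈ lieC G hG, (Zᴴ * D).trace = 0) :
    ∀ Z ∈ lieC G hG, (Zᴴ * Dᴴ).trace = 0 := by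
  intro Z hZ
  have h := hD _ (conjTranspose_mem_lieC G hG hZ)
  rw [Matrix.conjTranspose_conjTranspose] at h
  rw [← Matrix.conjTranspose_mul, Matrix.trace_conjTranspose, Matrix.trace_mul_comm, h, star_zero]

/-- **`π` commutes with the adjoint: `π(X*) = (πX)*`** (so `π` maps Hermitian to Hermitian and skew to skew: print's `π Im ∂U` with
`Im U = (U − U⁻¹)/2i`). [cite: Balaban1987RG1, (1.8) p.261] -/
theorem proj_conjTranspose (X : Matrix n n ℂ) : proj G hG Xᴴ = (proj G hG X)ᴴ := by
  refine proj_eq_of_mem_of_orthogonal G hG (conjTranspose_mem_lieC G hG (proj_mem G hG X)) ?_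
  have h := orthogonal_conjTranspose G hG (fun W hW => trace_conjTranspose_mul_sub_proj G hG hW X)
  simpa only [Matrix.conjTranspose_sub] using h

/-- **On `𝔲(N)` the projection lands in the REAL Lie algebra `𝐠`**: for skew-Hermitian `X` (`X* = −X`), `πX ∈ 𝐠 = lieSubalgebra G`
(`πX` is skew by `proj_conjTranspose` and lies in `𝐠ᶜ`; `𝐠ᶜ ∩ 𝔲(N) = 𝐠`, p24's (8.3)(iv)) — [12] §A «Its Lie algebra g is a subalgebra of
the algebra of hermitian matrices» in the tree's convention `𝐠 ⊆ 𝔲(N)` (`𝐠_print = i𝐠`). [cite: Balaban1985Averaging, §A p.20; Balaban1987RG1, (1.8) p.261] -/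
theorem proj_mem_lieSubalgebra_of_star_eq_neg {X : Matrix n n ℂ} (hX : star X = -X) :
    proj G hG X ∈ lieSubalgebra G hG := by
  refine mem_lieSubalgebra_of_mem_lieHull G hG ?_ (lieC_le_lieHull G hG (proj_mem G hG X))
  rw [Matrix.star_eq_conjTranspose, ← proj_conjTranspose, ← Matrix.star_eq_conjTranspose, hX, map_neg]

/-- The Hermitian reading (print's convention `G = exp(i𝐠_print)`, `𝐠_print` Hermitian): for Hermitian `X` (`X* = X`), `πX` is Hermitian
and `i·πX ∈ 𝐠`, i.e. `πX ∈ 𝐠_print = −i𝐠`. [cite: Balaban1985Averaging, §A p.20; Balaban1987RG1, (1.8) p.261] -/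
theorem I_smul_proj_mem_lieSubalgebra_of_star_eq {X : Matrix n n ℂ} (hX : star X = X) :
    Complex.I • proj G hG X ∈ lieSubalgebra G hG := by
  rw [← map_smul]
  refine proj_mem_lieSubalgebra_of_star_eq_neg G hG ?_
  rw [star_smul, hX, Complex.star_def, Complex.conj_I, neg_smul]

end Star

/-! ## §4. The bound (20): `π` is a contraction for the `L²` norm (17) and `|πX| ≤ √N |X|` in the operator norm (19) -/

section NormBound

open scoped Matrix.Norms.L2Operator

variable [Fintype n] [DecidableEq n] (G : Subgroup (UN n)) (hG : IsClosed (G : Set (UN n)))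

/-- **`π` contracts the `L²` norm (17)**: `Σ_{ij} |(πX)_{ij}|² ≤ Σ_{ij} |X_{ij}|²` (orthogonal projections have norm `≤ 1`).
[cite: Balaban1985Averaging, (17) p.20, (20) p.21] -/
theorem sum_norm_sq_proj_le (X : Matrix n n ℂ) : ∑ i, ∑ j, ‖proj G hG X i j‖ ^ 2 ≤ ∑ i, ∑ j, ‖X i j‖ ^ 2 := by
  rw [← norm_toE_sq, ← norm_toE_sq, toE_proj]
  exact pow_le_pow_left₀ (norm_nonneg _) (Submodule.norm_starProjection_apply_le _ _) 2

/-- The same for the normalized `L²` norm of [12] p. 21 (`MatrixNorms.nhsNormSq`): `‖πX‖² ≤ ‖X‖²`. [cite: Balaban1985Averaging, (20) p.21] -/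
theorem nhsNormSq_proj_le (X : Matrix n n ℂ) : MatrixNorms.nhsNormSq (proj G hG X) ≤ MatrixNorms.nhsNormSq X :=
  div_le_div_of_nonneg_right (sum_norm_sq_proj_le G hG X) (Nat.cast_nonneg _)

/-- `‖πX‖ ≤ ‖X‖` for the `L²` norm (17) of [12] p. 21. [cite: Balaban1985Averaging, (20) p.21] -/
theorem nhsNorm_proj_le (X : Matrix n n ℂ) : MatrixNorms.nhsNorm (proj G hG X) ≤ MatrixNorms.nhsNorm X :=
  Real.sqrt_le_sqrt (nhsNormSq_proj_le G hG X)

/-- **`|πX| ≤ √N |X|` in the operator norm (19)** — by (20): `|πX| ≤ √N ‖πX‖ ≤ √N ‖X‖ ≤ √N |X|` (tree `MatrixNorms`: (20) proved);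
this is the constant `Cπ` of the hypothesis `hπn : ‖π X‖ ≤ Cπ‖X‖` of `B12CondIIIJConcrete` (`Cπ = 1` for `U(N)`, `2` for p07's `slProj`).
[cite: Balaban1985Averaging, (20) p.21; Balaban1987RG1, (1.8) p.261] -/
theorem norm_proj_le (X : Matrix n n ℂ) : ‖proj G hG X‖ ≤ Real.sqrt (Fintype.card n) * ‖X‖ := by
  have h1 : ‖proj G hG X‖ ^ 2 ≤ ∑ i, ∑ j, ‖proj G hG X i j‖ ^ 2 := MatrixNorms.opNorm_sq_le_sum_norm_sq _
  have h3 : ∑ i, ∑ j, ‖X i j‖ ^ 2 ≤ Fintype.card n * ‖X‖ ^ 2 := by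
    rcases isEmpty_or_nonempty n with hn | hn
    · simp
    · rw [← MatrixNorms.card_mul_nhsNormSq]
      exact mul_le_mul_of_nonneg_left (MatrixNorms.nhsNormSq_le_opNorm_sq X) (Nat.cast_nonneg _)
  have h : ‖proj G hG X‖ ^ 2 ≤ (Real.sqrt (Fintype.card n) * ‖X‖) ^ 2 := by
    rw [mul_pow, Real.sq_sqrt (Nat.cast_nonneg _)]
    exact h1.trans ((sum_norm_sq_proj_le G hG X).trans h3)
  exact (sq_le_sq₀ (norm_nonneg _) (by positivity)).1 h

end NormBound

/-! ## §5. Agreement with the two hand-made projections of the lineage: `G = U(N)` (`π = id`) and `G = SU(N)` (p07's `slProj`) -/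

section Agreement

open Literature.MathematicalPhysics.QuantumFieldTheory.Balaban1983to89.B12ComplexifiedGroup (isClosed_top)
open Literature.MathematicalPhysics.QuantumFieldTheory.Balaban1983to89.B12SpecialUnitaryClosedSubgroup (specialUnitarySubgroup
  isClosed_specialUnitarySubgroup lieC_specialUnitarySubgroup)
open Literature.MathematicalPhysics.QuantumFieldTheory.Balaban1983to89.B12RegularSpaces111ClosedSubgroup (lieC_top_eq_top)
open Literature.Algebra.Lie.SpecialLinearKilling (mem_sl_iff)

variable [Fintype n] [DecidableEq n]

/-- **`G = U(N)`: `π = id`** (`𝐠ᶜ(U(N)) = M_N(ℂ)`; p07's `B12Eq18Current.current_id_eq_J`: for `π = id` (1.8) IS the current (3.11) of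
[15]). [cite: Balaban1987RG1, (1.8) p.261; Balaban1985Averaging, §A p.20] -/
theorem proj_top_apply (X : Matrix n n ℂ) : proj (⊤ : Subgroup (UN n)) isClosed_top X = X :=
  proj_eq_self_of_mem _ _ (by rw [lieC_top_eq_top]; trivial)

/-- `G = U(N)`: `π = id` as linear maps. [cite: Balaban1987RG1, (1.8) p.261] -/
theorem proj_top : proj (⊤ : Subgroup (UN n)) isClosed_top = LinearMap.id :=
  LinearMap.ext proj_top_apply

/-- **`G = SU(N)`: `π` IS p07's traceless part `slProj N`, `X ↦ X − (tr X / N)·1`** — the orthogonal projection for (17) onto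
`𝐠ᶜ(SU(N)) = 𝔰𝔩(N, ℂ)` (the scalars `ℂ·1` are the (17)-orthogonal complement of the traceless matrices).
[cite: Balaban1987RG1, (1.8) p.261, §0 p.252] -/
theorem proj_specialUnitary_apply (N : ℕ) [NeZero N] (X : Matrix (Fin N) (Fin N) ℂ) :
    proj (specialUnitarySubgroup (Fin N)) (isClosed_specialUnitarySubgroup (Fin N)) X = B12Lemma4Models.slProj N X := by
  refine proj_eq_of_mem_of_orthogonal _ _ ?_ fun Z hZ => ?_
  · rw [lieC_specialUnitarySubgroup, mem_sl_iff]
    exact B12Lemma4Models.trace_slProj X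
  · rw [lieC_specialUnitarySubgroup, mem_sl_iff] at hZ
    rw [B12Lemma4Models.slProj_apply, sub_sub_cancel, Matrix.mul_smul, Matrix.trace_smul, Matrix.mul_one,
      Matrix.trace_conjTranspose, hZ, star_zero, smul_zero]

/-- `G = SU(N)`: `π = slProj N` as linear maps. [cite: Balaban1987RG1, (1.8) p.261] -/
theorem proj_specialUnitary (N : ℕ) [NeZero N] :
    proj (specialUnitarySubgroup (Fin N)) (isClosed_specialUnitarySubgroup (Fin N)) = B12Lemma4Models.slProj N :=
  LinearMap.ext (proj_specialUnitary_apply N)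

end Agreement

/-! ## §6. The current (1.8) WITH THE PRINTED `π`, for every closed `G ≤ U(N)`: the three model hypotheses of the lineage
(`heGc`, `hπ`, `hgc`) and the covariance hypothesis of `B12Eq18Current` discharged on gen 16's `closedSubgroupModel G` -/

section Current

open scoped Matrix.Norms.L2Operator
open Literature.MathematicalPhysics.QuantumFieldTheory.Balaban1983to89.B12RegularSpaces111
open Literature.MathematicalPhysics.QuantumFieldTheory.Balaban1983to89.B12RegularSpaces111ClosedSubgroup (closedSubgroupModel
  closedSubgroupModel_Gc mem_closedSubgroupModel_gc_iff closedSubgroupModel_expI_mem_Gc)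

variable [Fintype n] [DecidableEq n] (G : Subgroup (UN n)) (hG : IsClosed (G : Set (UN n)))
variable {P : Params} {i : ℕ}

/-- **`hπ` DISCHARGED**: the printed `π` takes values in the model's `𝐠ᶜ`. [cite: Balaban1987RG1, (1.8) p.261] -/
theorem closedSubgroupModel_hπ : ∀ X, proj G hG X ∈ (closedSubgroupModel G hG).gc := fun X => proj_mem G hG X

/-- **`heGc`** in the plain form used by `B12Lemma4Space`: `exp iξA ∈ Gᶜ` for `A ∈ 𝐠ᶜ` (gen 16's family form, specialised).
[cite: Balaban1987RG1, (1.10) p.262] -/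
theorem closedSubgroupModel_heGc (ξ : ℝ) : ∀ A ∈ (closedSubgroupModel G hG).gc, expI ξ A ∈ (closedSubgroupModel G hG).Gc :=
  fun A hA => closedSubgroupModel_expI_mem_Gc G hG ξ (E := fun _ : Unit => A) (fun _ => hA) ()

/-- **`hgc` over the whole `Gᶜ`**: `𝐠ᶜ` is `Ad(Gᶜ)`-stable, in the letters `B9Eq39Adjoint.R g X = gXg⁻¹` of `B12Eq18Current` /
`B12Lemma4Space` / `B12Eq117Concrete` (gen 16's `conj_mem_lieC`). [cite: Balaban1987RG1, (1.10) p.262] -/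
theorem closedSubgroupModel_hgc_Gc : ∀ g ∈ (closedSubgroupModel G hG).Gc, ∀ X ∈ (closedSubgroupModel G hG).gc,
    B9Eq39Adjoint.R g X ∈ (closedSubgroupModel G hG).gc :=
  fun _ hg _ hX => conj_mem_lieC G hG hg hX

/-- **GAUGE COVARIANCE OF THE CURRENT (1.8) WITH THE PRINTED `π`, hypothesis-free for every closed `G ≤ U(N)`**: for EVERY
`Gᶜ`-valued gauge transformation `u`, `J(𝐔^u)(b) = R(u(b₋)) J(𝐔)(b)` (p07's `B12Eq18Current.current_gaugeU` with its `hπ` = §3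
`proj_R`). [cite: Balaban1987RG1, (1.10) p.262] -/
theorem current_gaugeU_closed (ξ : ℝ) {u : Site P i → (Matrix n n ℂ)ˣ} (hu : ∀ x, u x ∈ complexifiedGroup G)
    (U : PBond P i → (Matrix n n ℂ)ˣ) (b : PBond P i) :
    B12Eq18Current.current (proj G hG) ξ (gaugeU u U) b =
      B9Eq39Adjoint.R (u b.src) (B12Eq18Current.current (proj G hG) ξ U b) :=
  B12Eq18Current.current_gaugeU (proj G hG) ξ u (fun x X => proj_R G hG (hu x) X) U b

/-- The same in the letters of (1.10): `J(𝐔^u) = R(u)J(𝐔)` (`B12RegularSpaces111.adJ`), every `Gᶜ`-valued `u`.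
[cite: Balaban1987RG1, (1.10) p.262] -/
theorem current_gaugeU_eq_adJ_closed (ξ : ℝ) {u : Site P i → (Matrix n n ℂ)ˣ} (hu : ∀ x, u x ∈ complexifiedGroup G)
    (U : PBond P i → (Matrix n n ℂ)ˣ) :
    B12Eq18Current.current (proj G hG) ξ (gaugeU u U) = adJ u (B12Eq18Current.current (proj G hG) ξ U) :=
  B12Eq18Current.current_gaugeU_eq_adJ (proj G hG) ξ u (fun x X => proj_R G hG (hu x) X) U

/-- **(1.9) intertwines (1.10), hypothesis-free for every closed `G ≤ U(N)`**: `(𝐔^u, J(𝐔^u)) = (𝐔, J(𝐔))^u` for every `Gᶜ`-valued `u`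
(p07's `B12Eq18Current.ofBackground_gaugeU`). [cite: Balaban1987RG1, (1.9) p.261, (1.10) p.262] -/
theorem ofBackground_gaugeU_closed (ξ : ℝ) {u : Site P i → (Matrix n n ℂ)ˣ} (hu : ∀ x, u x ∈ complexifiedGroup G)
    (U : PBond P i → (Matrix n n ℂ)ˣ) :
    B12Eq18Current.ofBackground (proj G hG) ξ (gaugeU u U) = act u (B12Eq18Current.ofBackground (proj G hG) ξ U) :=
  B12Eq18Current.ofBackground_gaugeU (proj G hG) ξ u (fun x X => proj_R G hG (hu x) X) U

/-- **«the configuration 𝐉 … has values in 𝐠ᶜ» for `𝐉 = J(𝐔)` with the printed `π`, hypothesis-free**: for every `Gᶜ`-valued `𝐔`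
the current (1.8) is `𝐠ᶜ`-valued (p07's `current_mem_gc` with `hπ`, `hgc` = §2/§3). [cite: Balaban1987RG1, (1.8) p.261, (1.10) p.262] -/
theorem current_mem_lieC (ξ : ℝ) {U : PBond P i → (Matrix n n ℂ)ˣ} (hU : ∀ b, U b ∈ complexifiedGroup G) (b : PBond P i) :
    B12Eq18Current.current (proj G hG) ξ U b ∈ lieC G hG :=
  B12Eq18Current.current_mem_gc (closedSubgroupModel G hG) (proj G hG) (closedSubgroupModel_hπ G hG)
    (closedSubgroupModel_hgc_Gc G hG) ξ hU b

/-- **`|J| ≤ √N·|D^{ξ*}ξ⁻² Im ∂𝐔|`-type control: the constant `Cπ = √N`** for the printed `π` in the `J`-budget ladder of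
`B12CondIIIJConcrete` (`norm_current_lt_alpha0` with `hπn` = §4 `norm_proj_le`): `|𝐉| < α₀` for the Lemma-4 configuration, the one
`π`-dependent restriction reading `4(d−1)·√N·C_F(1)·(B₃²O₁M)²·α₀ ≤ β`. [cite: Balaban1987RG1, p.280 after (3.52); Balaban1985Averaging, (20) p.21] -/
theorem norm_current_lt_alpha0_closed [Nonempty n] (c : B12Sec2to5.Lemma4Consts) (hR : B12Sec2to5.Lemma4Restrictions c)
    (hB : 1 ≤ c.B₃) (hY : 1 ≤ c.B₃ ^ 2 * c.O₁ * c.M) {ξ η τ m B₃'' : ℝ} {j : ℕ} {H H₁ K A : PBond P i → Matrix n n ℂ}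
    (hresJ : 4 * ((P.d - 1) * (Real.sqrt (Fintype.card n) * B12Eq311CurrentExpansion.C311 1)) * (c.B₃ ^ 2 * c.O₁ * c.M) ^ 2 * c.α₀ ≤ c.β)
    (hres'' : B₃'' * c.α₃ ≤ c.β * c.L⁻¹ ^ 2 * c.α₀)
    (hξ : 0 < ξ) (hξ1 : ξ ≤ 1) (hη : 0 ≤ η) (hj : 1 ≤ j) (hscale : c.L ^ j * η ≤ 1) (hτ0 : 0 ≤ τ) (hτ1 : τ ≤ 1)
    (hm : m < c.α₃) (hB'' : 0 ≤ B₃'')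
    (hHg : ∀ b, ‖H b‖ ≤ c.B₃ ^ 2 * c.O₁ * c.M * c.α₀ * (c.L ^ (j - 1) * η))
    (hHd : ∀ μ ν y, ‖grad ξ μ (fun z => H ⟨z, ν⟩) y‖ ≤ c.B₃ ^ 2 * c.O₁ * c.M * c.α₀ * (c.L ^ (j - 1) * η))
    (hKg : ∀ b, ‖K b‖ ≤ c.B₃ ^ 2 * c.O₁ * c.M * c.α₀ * (c.L ^ (j - 1) * η))
    (hKd : ∀ μ ν y, ‖grad ξ μ (fun z => K ⟨z, ν⟩) y‖ ≤ c.B₃ ^ 2 * c.O₁ * c.M * c.α₀ * (c.L ^ (j - 1) * η))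
    (hAg : ∀ b, ‖A b‖ ≤ c.B₃ * m) (hAd : ∀ μ ν y, ‖grad ξ μ (fun z => A ⟨z, ν⟩) y‖ ≤ c.B₃ * m) (b : PBond P i)
    (h42 : ‖B12Eq18Current.current (proj G hG) ξ (fun b => expI ξ (H b)) b‖ < (1 + 3 * c.β) * c.α₀ * (c.L ^ (j - 1) * η) ^ 3)
    (hS : ‖B12Eq311CurrentExpansion.lapCur (proj G hG) ξ (1 : PBond P i → (Matrix n n ℂ)ˣ) (H - H₁) b‖ <
      c.β * c.α₀ * (c.L ^ (j - 1) * η) ^ 2)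
    (hSτ : ‖B12Eq311CurrentExpansion.lapCur (proj G hG) ξ (1 : PBond P i → (Matrix n n ℂ)ˣ) (K - (τ : ℂ) • H₁) b‖ <
      c.β * c.α₀ * (c.L ^ (j - 1) * η) ^ 2)
    (hA2 : ‖B12Eq311CurrentExpansion.lapCur (proj G hG) ξ (1 : PBond P i → (Matrix n n ℂ)ˣ) A b‖ ≤ B₃'' * m) :
    ‖B12Eq18Current.current (proj G hG) ξ (fun b => expI ξ (K b + A b)) b‖ < c.α₀ :=
  B12CondIIIJConcrete.norm_current_lt_alpha0 c hR hB hY hresJ hres'' hξ hξ1 hη hj hscale hτ0 hτ1 hm hB'' (Real.sqrt_nonneg _)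
    (norm_proj_le G hG) hHg hHd hKg hKd hAg hAd b h42 hS hSτ hA2

/-- **LEMMA 4, MEMBERSHIP OF THE PRINTED PAIR `(𝐔, J(𝐔))`, FOR EVERY CLOSED `G ≤ U(N)`** (print's standing case «G … a Lie subgroup
of … U(N)», the current with the printed projection `π` onto `𝐠ᶜ`): p07's `B12Lemma4Space.ofBackground_mem_space'_lemma4` on gen 16's
`closedSubgroupModel G` with its three model hypotheses `heGc`, `hπ`, `hgc` DISCHARGED; «𝐠ᶜ-valued» for `𝐊`, `𝐀₂` reads `∈ lieC G`.
All remaining hypotheses are the by-reference inputs of the print listed in `B12Lemma4Space` ((3.37), (3.41), (3.45), (3.50), the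
J-half, (iv)). [cite: Balaban1987RG1, Lemma 4 (3.53) p.280] -/
theorem ofBackground_mem_space'_lemma4_closed (c : B12Sec2to5.Lemma4Consts) (hR : B12Sec2to5.Lemma4Restrictions c)
    (hB : 1 ≤ c.B₃) (hY : 1 ≤ c.B₃ ^ 2 * c.O₁ * c.M) (hα₁ : 16 * (c.O₁ * c.M * c.α₁) ≤ c.β)
    {F : Frame P i (Matrix n n ℂ)} {cs : StepConsts} (hξ : 0 < cs.ξ) (hξ1 : cs.ξ ≤ 1) (hcB : 0 < cs.cB)
    {η τ m : ℝ} {j : ℕ} (hη : 0 ≤ η) (hj : 1 ≤ j) (hscale : c.L ^ j * η ≤ 1)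
    (hξx : cs.ξ * (c.L ^ (j - 1) * η) = c.L⁻¹ * η) (hτ0 : 0 ≤ τ) (hτ1 : τ ≤ 1) (hm : m < c.α₃)
    {Y : Region P i} (hXb : F.X.bonds ⊆ Y.bonds) (hXd : F.X.dpairs ⊆ Y.dpairs)
    (hXp : ∀ p ∈ F.X.plaqs, (⟨p.src, p.μ⟩ : PBond P i) ∈ Y.bonds ∧ (⟨p.src.shift p.μ, p.ν⟩ : PBond P i) ∈ Y.bonds ∧
      (⟨p.src.shift p.ν, p.μ⟩ : PBond P i) ∈ Y.bonds ∧ (⟨p.src, p.ν⟩ : PBond P i) ∈ Y.bonds ∧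
      (p.src, p.μ, p.ν) ∈ Y.dpairs ∧ (p.src, p.ν, p.μ) ∈ Y.dpairs)
    {H K A : PBond P i → Matrix n n ℂ} {ℓ : Plaq P i → Matrix n n ℂ} (hKgc : ∀ b, K b ∈ lieC G hG)
    (hAgc : ∀ b, A b ∈ lieC G hG)
    (h41 : ∀ p ∈ F.X.plaqs, ‖((plaq (fun b => expI cs.ξ (H b)) p : (Matrix n n ℂ)ˣ) : Matrix n n ℂ) - 1‖ <
      Real.exp (c.B₃ ^ 2 * c.O₁ * c.M * c.α₀) * Real.exp (c.B₃ * c.O₁ * c.M * c.α₀) *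
      Real.exp (c.B₃ * c.O₁ * c.M * c.α₀) * Real.exp (c.O₁ * c.M * c.α₁) *
      ((1 + 2 * c.β) * c.α₀ * (c.L⁻¹ * η) ^ 2))
    (hH : ∀ b ∈ Y.bonds, ‖H b‖ < c.B₃ ^ 2 * c.O₁ * c.M * c.α₀ * (c.L ^ (j - 1) * η))
    (h45 : ∀ p ∈ F.X.plaqs, ‖(cs.ξ : ℂ)⁻¹ • (H ⟨p.src, p.μ⟩ + H ⟨p.src.shift p.μ, p.ν⟩ - H ⟨p.src.shift p.ν, p.μ⟩ -
      H ⟨p.src, p.ν⟩) - ℓ p‖ < c.B₃ * (c.B₃ * c.O₁ * c.M * c.α₀ * (c.L ^ (j - 1) * η)) ^ 2)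
    (hK : ∀ b ∈ Y.bonds, ‖K b‖ < c.B₃ ^ 2 * c.O₁ * c.M * c.α₀ * (c.L ^ (j - 1) * η))
    (hK1 : ∀ q ∈ Y.dpairs, ‖grad cs.ξ q.2.1 (fun y => K ⟨y, q.2.2⟩) q.1‖ < c.B₃ ^ 2 * c.O₁ * c.M * c.α₀ * (c.L ^ (j - 1) * η))
    (h45τ : ∀ p ∈ F.X.plaqs, ‖(cs.ξ : ℂ)⁻¹ • (K ⟨p.src, p.μ⟩ + K ⟨p.src.shift p.μ, p.ν⟩ - K ⟨p.src.shift p.ν, p.μ⟩ -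
      K ⟨p.src, p.ν⟩) - (τ : ℂ) • ℓ p‖ < c.B₃ * (c.B₃ * c.O₁ * c.M * c.α₀ * (c.L ^ (j - 1) * η)) ^ 2)
    (hA : ∀ b ∈ Y.bonds, ‖A b‖ ≤ c.B₃ * m)
    (hdA : ∀ q ∈ Y.dpairs, ‖grad cs.ξ q.2.1 (fun y => A ⟨y, q.2.2⟩) q.1‖ ≤ c.B₃ * m)
    (hJ : ∀ b ∈ F.X.bonds, ‖B12Eq18Current.current (proj G hG) cs.ξ (fun b => expI cs.ξ (K b + A b)) b‖ < c.α₀)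
    (hIV : CondIV F.bg F.X₂ cs c.α₀ (fun b => expI cs.ξ (K b + A b)))
    (hIV₁ : CondIV F.bg F.X₂ cs c.α₀ (1 : PBond P i → (Matrix n n ℂ)ˣ)) :
    B12Eq18Current.ofBackground (proj G hG) cs.ξ (fun b => expI cs.ξ (K b + A b)) ∈
      space' (closedSubgroupModel G hG) F cs c.α₀ c.α₁ :=
  B12Lemma4Space.ofBackground_mem_space'_lemma4 (closedSubgroupModel G hG) c hR hB hY hα₁ hξ hξ1 hcB hη hj hscale hξx hτ0
    hτ1 hm (closedSubgroupModel_heGc G hG cs.ξ) (proj G hG) (closedSubgroupModel_hπ G hG) (closedSubgroupModel_hgc_Gc G hG)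
    hXb hXd hXp hKgc hAgc h41 hH h45 hK hK1 h45τ hA hdA hJ hIV hIV₁

/-- **Lemma 4 in the letters of (3.37)/(3.53), every closed `G ≤ U(N)`**: print's configuration is `U_j(□₀, ·) = (exp iξ𝐇_j(□₀, ·))^{u_j}`
((3.37)), a gauge transform of `exp iξ𝐊`; with the current's covariance (`ofBackground_gaugeU_closed`) and the gauge invariance of the
space (`B12RegularSpaces111.act_mem_space`), the pair `((exp iξ𝐊)^u, J((exp iξ𝐊)^u))` lies in `U^c_j(X, α₀, α₁)` for every
`Gᶜ`-valued `u` under the hypotheses of `ofBackground_mem_space'_lemma4_closed`. [cite: Balaban1987RG1, Lemma 4 (3.53) p.280 with (3.37) p.277] -/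
theorem gaugeU_ofBackground_mem_space'_lemma4_closed (c : B12Sec2to5.Lemma4Consts) (hR : B12Sec2to5.Lemma4Restrictions c)
    (hB : 1 ≤ c.B₃) (hY : 1 ≤ c.B₃ ^ 2 * c.O₁ * c.M) (hα₁ : 16 * (c.O₁ * c.M * c.α₁) ≤ c.β)
    {F : Frame P i (Matrix n n ℂ)} {cs : StepConsts} (hξ : 0 < cs.ξ) (hξ1 : cs.ξ ≤ 1) (hcB : 0 < cs.cB)
    {η τ m : ℝ} {j : ℕ} (hη : 0 ≤ η) (hj : 1 ≤ j) (hscale : c.L ^ j * η ≤ 1)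
    (hξx : cs.ξ * (c.L ^ (j - 1) * η) = c.L⁻¹ * η) (hτ0 : 0 ≤ τ) (hτ1 : τ ≤ 1) (hm : m < c.α₃)
    {Y : Region P i} (hXb : F.X.bonds ⊆ Y.bonds) (hXd : F.X.dpairs ⊆ Y.dpairs)
    (hXp : ∀ p ∈ F.X.plaqs, (⟨p.src, p.μ⟩ : PBond P i) ∈ Y.bonds ∧ (⟨p.src.shift p.μ, p.ν⟩ : PBond P i) ∈ Y.bonds ∧
      (⟨p.src.shift p.ν, p.μ⟩ : PBond P i) ∈ Y.bonds ∧ (⟨p.src, p.ν⟩ : PBond P i) ∈ Y.bonds ∧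
      (p.src, p.μ, p.ν) ∈ Y.dpairs ∧ (p.src, p.ν, p.μ) ∈ Y.dpairs)
    {H K A : PBond P i → Matrix n n ℂ} {ℓ : Plaq P i → Matrix n n ℂ} (hKgc : ∀ b, K b ∈ lieC G hG)
    (hAgc : ∀ b, A b ∈ lieC G hG)
    (h41 : ∀ p ∈ F.X.plaqs, ‖((plaq (fun b => expI cs.ξ (H b)) p : (Matrix n n ℂ)ˣ) : Matrix n n ℂ) - 1‖ <
      Real.exp (c.B₃ ^ 2 * c.O₁ * c.M * c.α₀) * Real.exp (c.B₃ * c.O₁ * c.M * c.α₀) *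
      Real.exp (c.B₃ * c.O₁ * c.M * c.α₀) * Real.exp (c.O₁ * c.M * c.α₁) *
      ((1 + 2 * c.β) * c.α₀ * (c.L⁻¹ * η) ^ 2))
    (hH : ∀ b ∈ Y.bonds, ‖H b‖ < c.B₃ ^ 2 * c.O₁ * c.M * c.α₀ * (c.L ^ (j - 1) * η))
    (h45 : ∀ p ∈ F.X.plaqs, ‖(cs.ξ : ℂ)⁻¹ • (H ⟨p.src, p.μ⟩ + H ⟨p.src.shift p.μ, p.ν⟩ - H ⟨p.src.shift p.ν, p.μ⟩ -
      H ⟨p.src, p.ν⟩) - ℓ p‖ < c.B₃ * (c.B₃ * c.O₁ * c.M * c.α₀ * (c.L ^ (j - 1) * η)) ^ 2)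
    (hK : ∀ b ∈ Y.bonds, ‖K b‖ < c.B₃ ^ 2 * c.O₁ * c.M * c.α₀ * (c.L ^ (j - 1) * η))
    (hK1 : ∀ q ∈ Y.dpairs, ‖grad cs.ξ q.2.1 (fun y => K ⟨y, q.2.2⟩) q.1‖ < c.B₃ ^ 2 * c.O₁ * c.M * c.α₀ * (c.L ^ (j - 1) * η))
    (h45τ : ∀ p ∈ F.X.plaqs, ‖(cs.ξ : ℂ)⁻¹ • (K ⟨p.src, p.μ⟩ + K ⟨p.src.shift p.μ, p.ν⟩ - K ⟨p.src.shift p.ν, p.μ⟩ -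
      K ⟨p.src, p.ν⟩) - (τ : ℂ) • ℓ p‖ < c.B₃ * (c.B₃ * c.O₁ * c.M * c.α₀ * (c.L ^ (j - 1) * η)) ^ 2)
    (hA : ∀ b ∈ Y.bonds, ‖A b‖ ≤ c.B₃ * m)
    (hdA : ∀ q ∈ Y.dpairs, ‖grad cs.ξ q.2.1 (fun y => A ⟨y, q.2.2⟩) q.1‖ ≤ c.B₃ * m)
    (hJ : ∀ b ∈ F.X.bonds, ‖B12Eq18Current.current (proj G hG) cs.ξ (fun b => expI cs.ξ (K b + A b)) b‖ < c.α₀)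
    (hIV : CondIV F.bg F.X₂ cs c.α₀ (fun b => expI cs.ξ (K b + A b)))
    (hIV₁ : CondIV F.bg F.X₂ cs c.α₀ (1 : PBond P i → (Matrix n n ℂ)ˣ)) (u : Site P i → (Matrix n n ℂ)ˣ)
    (hu : ∀ x, u x ∈ complexifiedGroup G) :
    B12Eq18Current.ofBackground (proj G hG) cs.ξ (gaugeU u fun b => expI cs.ξ (K b + A b)) ∈
      space' (closedSubgroupModel G hG) F cs c.α₀ c.α₁ := by
  rw [ofBackground_gaugeU_closed G hG cs.ξ hu]
  exact act_mem_space (ofBackground_mem_space'_lemma4_closed G hG c hR hB hY hα₁ hξ hξ1 hcB hη hj hscale hξx hτ0 hτ1 hm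
    hXb hXd hXp hKgc hAgc h41 hH h45 hK hK1 h45τ hA hdA hJ hIV hIV₁) hu

/-- **THE (1.17) SPECIALISATION `(𝐔, 𝐉 = D^{ξ*}_𝐔ξ⁻²π Im ∂𝐔)`, EVERY CLOSED `G ≤ U(N)`**: p07's
`B12Eq117Concrete.ofBackground_mem_space'_of_prop9Shape` on `closedSubgroupModel G` with the printed `π`, its `hπ`, `hgc` DISCHARGED;
«Gᶜ-valued» for `𝐔` reads `𝐔(b) ∈ complexifiedGroup G`. [cite: Balaban1987RG1, (1.17) p.263] -/
theorem ofBackground_mem_space'_of_prop9Shape_closed {F : Frame P i (Matrix n n ℂ)} {c : StepConsts} (hcB : 0 ≤ c.cB)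
    (hL : c.L ≠ 0) {B₃ α₀' α₁' α₀ α₁ : ℝ} (h₀ : α₀' ≤ α₀) (h₁ : α₁' ≤ α₁) (hsmall : 2 * B₃ * α₀' ≤ α₀)
    (h117 : ∀ V : PBond P i → (Matrix n n ℂ)ˣ, (∀ p ∈ F.X.plaqs, ‖(↑(plaq V p) : Matrix n n ℂ) - 1‖ < α₀' * c.ξ ^ 2) →
      ∀ k, 1 ≤ k → k ≤ c.j →
      (∀ p ∈ F.X₂.plaqs, ‖(↑(plaq (F.bg.Un k V) p) : Matrix n n ℂ) - 1‖ < B₃ * (2 * α₀') * (c.L ^ k)⁻¹ ^ 2 * (c.L ^ k * c.ξ) ^ 2) ∧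
      (∀ b ∈ F.X₂.bonds, ‖F.bg.Jn k V b‖ < B₃ * (2 * α₀') * (c.L ^ k * c.ξ) ^ 2))
    {Uc U : PBond P i → (Matrix n n ℂ)ˣ} {A' : PBond P i → Matrix n n ℂ} (hUc : ∀ b, Uc b ∈ complexifiedGroup G)
    (hf : Factors c Uc U A') (hI : CondI (closedSubgroupModel G hG) F c α₀' U)
    (hII : CondII (closedSubgroupModel G hG) F.X c α₁' U A')
    (hplaq : ∀ p ∈ F.X.plaqs, ‖(↑(plaq Uc p) : Matrix n n ℂ) - 1‖ < α₀' * c.ξ ^ 2)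
    (hJ : ∀ b ∈ F.X.bonds, ‖B12Eq18Current.current (proj G hG) c.ξ Uc b‖ < α₀') :
    B12Eq18Current.ofBackground (proj G hG) c.ξ Uc ∈ space' (closedSubgroupModel G hG) F c α₀ α₁ :=
  B12Eq117Concrete.ofBackground_mem_space'_of_prop9Shape (closedSubgroupModel G hG) hcB hL h₀ h₁ hsmall h117 (proj G hG)
    (closedSubgroupModel_hπ G hG) (closedSubgroupModel_hgc_Gc G hG) hUc hf hI hII hplaq hJ

end Current

/-! ## §7. Lemma 4 with condition (iv) DERIVED from (3.38) and the J-half of (iii) DERIVED, for every closed `G ≤ U(N)` —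
p07's `hπR : ∀ g ∈ GL(N, ℂ)` (false for the printed `π` unless `G = U(N)` or `SU(N)`-like) REPLACED by «`u_j`, `w` are `Gᶜ`-valued» -/

section CondIVClosed

open scoped Matrix.Norms.L2Operator
open Literature.MathematicalPhysics.QuantumFieldTheory.Balaban1983to89.B12RegularSpaces111
open Literature.MathematicalPhysics.QuantumFieldTheory.Balaban1983to89.B12RegularSpaces111ClosedSubgroup (closedSubgroupModel)
open Literature.MathematicalPhysics.QuantumFieldTheory.Balaban1983to89.B12Eq18Current (current ofBackground)
open Literature.MathematicalPhysics.QuantumFieldTheory.Balaban1983to89.B12Eq338CondIV (condIV_of_eq338 condIV_one_of_eq338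
  cost_mul_inv_le margin352_of_restrictions)
open Literature.MathematicalPhysics.QuantumFieldTheory.Balaban1983to89.B12Lemma4CondIV (ineq352_region jBudget_lt_352_of_restrictions)
open Literature.MathematicalPhysics.QuantumFieldTheory.Balaban1983to89.B12Eq311CurrentExpansion (lapCur C311)
open Literature.MathematicalPhysics.QuantumFieldTheory.Balaban1983to89.B12CondIIIJConcrete (norm_current_lt_jBudget)

variable [Fintype n] [DecidableEq n] (G : Subgroup (UN n)) (hG : IsClosed (G : Set (UN n)))
variable {P : Params} {i : ℕ}

/-- A site-wise product `u_j·ū⁻¹` with `ū = u_j ∘ ctr` of a `Gᶜ`-valued `u_j` is `Gᶜ`-valued. [cite: Balaban1987RG1, (3.38) p.278] -/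
theorem mul_inv_apply_mem_complexifiedGroup {S : Type*} {uj ubar : S → (Matrix n n ℂ)ˣ} {ctr : S → S}
    (huj : ∀ y, uj y ∈ complexifiedGroup G) (hubar : ∀ x, ubar x = uj (ctr x)) (x : S) :
    (uj * ubar⁻¹ : S → (Matrix n n ℂ)ˣ) x ∈ complexifiedGroup G := by
  rw [Pi.mul_apply, Pi.inv_apply, hubar]
  exact (complexifiedGroup G).mul_mem (huj x) ((complexifiedGroup G).inv_mem (huj (ctr x)))

/-- **Condition (iv) (1.16) for `V = exp iξ(𝐇_j(□₀, τQ(…)) + 𝐀₂)` DERIVED from (3.38), printed `π`, every closed `G ≤ U(N)`**: p07's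
`B12Lemma4CondIV.condIV_lemma4_of_eq338` with `π = proj G hG` and its hypothesis «`π` commutes with `Ad` of ALL units» replaced by the
print-faithful «`u_j` is `Gᶜ`-valued» ((3.37): `u_j` a `Gᶜ`-valued gauge transformation; then `u_j·ū_j⁻¹` is `Gᶜ`-valued and §3 `proj_R`
applies). [cite: Balaban1987RG1, Lemma 4 (3.53) p.280 with (3.38) p.278] -/
theorem condIV_lemma4_of_eq338_closed (c : B12Sec2to5.Lemma4Consts) (hR : B12Sec2to5.Lemma4Restrictions c)
    (hB : 1 ≤ c.B₃) (hY : 1 ≤ c.B₃ ^ 2 * c.O₁ * c.M) (hα₁ : 16 * (c.O₁ * c.M * c.α₁) ≤ c.β) (hL10 : 1 + 10 * c.β ≤ c.L ^ 2)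
    {F : Frame P i (Matrix n n ℂ)} {cs : StepConsts} (hξ : 0 < cs.ξ) (hξ1 : cs.ξ ≤ 1) (hL : 1 ≤ cs.L) (hLξ : cs.L ^ cs.j * cs.ξ = 1)
    {η τ m B₃'' : ℝ} {j : ℕ} (hη : 0 ≤ η) (hj : 1 ≤ j) (hscale : c.L ^ j * η ≤ 1)
    (hξx : cs.ξ * (c.L ^ (j - 1) * η) = c.L⁻¹ * η) (hτ0 : 0 ≤ τ) (hτ1 : τ ≤ 1) (hm : m < c.α₃)
    (hres'' : B₃'' * c.α₃ ≤ c.β * c.L⁻¹ ^ 2 * c.α₀)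
    {Y : Region P i} (hX₂p : F.X₂.plaqs ⊆ F.X.plaqs)
    (hXp : ∀ p ∈ F.X.plaqs, (⟨p.src, p.μ⟩ : PBond P i) ∈ Y.bonds ∧ (⟨p.src.shift p.μ, p.ν⟩ : PBond P i) ∈ Y.bonds ∧
      (⟨p.src.shift p.ν, p.μ⟩ : PBond P i) ∈ Y.bonds ∧ (⟨p.src, p.ν⟩ : PBond P i) ∈ Y.bonds ∧
      (p.src, p.μ, p.ν) ∈ Y.dpairs ∧ (p.src, p.ν, p.μ) ∈ Y.dpairs)
    {H K A : PBond P i → Matrix n n ℂ} {ℓ : Plaq P i → Matrix n n ℂ}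
    (h41 : ∀ p ∈ F.X.plaqs, ‖((plaq (fun b => expI cs.ξ (H b)) p : (Matrix n n ℂ)ˣ) : Matrix n n ℂ) - 1‖ <
      Real.exp (c.B₃ ^ 2 * c.O₁ * c.M * c.α₀) * Real.exp (c.B₃ * c.O₁ * c.M * c.α₀) *
      Real.exp (c.B₃ * c.O₁ * c.M * c.α₀) * Real.exp (c.O₁ * c.M * c.α₁) *
      ((1 + 2 * c.β) * c.α₀ * (c.L⁻¹ * η) ^ 2))
    (hH : ∀ b ∈ Y.bonds, ‖H b‖ < c.B₃ ^ 2 * c.O₁ * c.M * c.α₀ * (c.L ^ (j - 1) * η))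
    (h45 : ∀ p ∈ F.X.plaqs, ‖(cs.ξ : ℂ)⁻¹ • (H ⟨p.src, p.μ⟩ + H ⟨p.src.shift p.μ, p.ν⟩ - H ⟨p.src.shift p.ν, p.μ⟩ -
      H ⟨p.src, p.ν⟩) - ℓ p‖ < c.B₃ * (c.B₃ * c.O₁ * c.M * c.α₀ * (c.L ^ (j - 1) * η)) ^ 2)
    (hK : ∀ b ∈ Y.bonds, ‖K b‖ < c.B₃ ^ 2 * c.O₁ * c.M * c.α₀ * (c.L ^ (j - 1) * η))
    (h45τ : ∀ p ∈ F.X.plaqs, ‖(cs.ξ : ℂ)⁻¹ • (K ⟨p.src, p.μ⟩ + K ⟨p.src.shift p.μ, p.ν⟩ - K ⟨p.src.shift p.ν, p.μ⟩ -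
      K ⟨p.src, p.ν⟩) - (τ : ℂ) • ℓ p‖ < c.B₃ * (c.B₃ * c.O₁ * c.M * c.α₀ * (c.L ^ (j - 1) * η)) ^ 2)
    (hA : ∀ b ∈ Y.bonds, ‖A b‖ ≤ c.B₃ * m)
    (hdA : ∀ q ∈ Y.dpairs, ‖grad cs.ξ q.2.1 (fun y => A ⟨y, q.2.2⟩) q.1‖ ≤ c.B₃ * m)
    (hJ₂ : ∀ b ∈ F.X₂.bonds, ‖current (proj G hG) cs.ξ (fun b => expI cs.ξ (K b + A b)) b‖ <
      (1 + 3 * c.β) * c.α₀ * (c.L ^ (j - 1) * η) ^ 3 + 3 * c.β * c.α₀ * (c.L ^ (j - 1) * η) ^ 2 + B₃'' * c.α₃ +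
        c.β * c.L⁻¹ ^ 2 * c.α₀)
    {uj : Site P i → (Matrix n n ℂ)ˣ} {ubar : ℕ → Site P i → (Matrix n n ℂ)ˣ} {ctr : ℕ → Site P i → Site P i}
    (hujGc : ∀ y, uj y ∈ complexifiedGroup G)
    (huj : ∀ y, ‖(uj y : Matrix n n ℂ)‖ * ‖(↑(uj y)⁻¹ : Matrix n n ℂ)‖ ≤ Real.exp (c.B₃ ^ 2 * c.O₁ * c.M * c.α₀))
    (hubar : ∀ k x, ubar k x = uj (ctr k x))
    (h338 : ∀ k, 1 ≤ k → k ≤ cs.j → ∀ p ∈ F.X₂.plaqs, plaq (F.bg.Un k (fun b => expI cs.ξ (K b + A b))) p =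
      plaq (gaugeU (uj * (ubar k)⁻¹) (fun b => expI cs.ξ (K b + A b))) p)
    (hJn : ∀ k, 1 ≤ k → k ≤ cs.j → ∀ b ∈ F.X₂.bonds, F.bg.Jn k (fun b => expI cs.ξ (K b + A b)) b =
      current (proj G hG) (cs.L ^ k)⁻¹ (gaugeU (uj * (ubar k)⁻¹) (fun b => expI cs.ξ (K b + A b))) b) :
    CondIV F.bg F.X₂ cs c.α₀ (fun b => expI cs.ξ (K b + A b)) := by
  have hmargin := margin352_of_restrictions c hR hY hL10
  have hE : 0 < Real.exp (c.B₃ ^ 2 * c.O₁ * c.M * c.α₀) * Real.exp (c.B₃ ^ 2 * c.O₁ * c.M * c.α₀) := by positivity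
  have h52 := ineq352_region c hR hB hY hα₁ hη hj hscale hξ hξ1 hξx hτ0 hτ1 hm hXp h41 hH h45 hK h45τ hA hdA
  have hbud := jBudget_lt_352_of_restrictions c hR hη hj hscale hres''
  refine condIV_of_eq338 (proj G hG) (w := fun k => uj * (ubar k)⁻¹) hξ hL hLξ h338 hJn
    (fun k x X => proj_R G hG (mul_inv_apply_mem_complexifiedGroup G hujGc (hubar k) x) X)
    (fun k x => cost_mul_inv_le huj (hubar k) x) hE (fun p hp => ?_) hmargin (fun b hb => (hJ₂ b hb).trans hbud) hmargin
  have h := h52 p (hX₂p hp)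
  calc _ < (1 + 8 * c.β) * c.L⁻¹ ^ 2 * c.α₀ * cs.ξ ^ 2 := h
    _ = _ := by ring

/-- **(iv) for the factor `U = 1`, printed `π`, every closed `G ≤ U(N)`**: p07's `condIV_one_of_eq338` with the rotation hypothesis supplied
by §3 `proj_R` for a `Gᶜ`-valued `w`. [cite: Balaban1987RG1, (3.38) p.278 with (1.16) p.262] -/
theorem condIV_one_of_eq338_closed {bg : BackgroundFns P i (Matrix n n ℂ)} {X₂ : Region P i} {cs : StepConsts} {α₀ : ℝ}
    {w : ℕ → Site P i → (Matrix n n ℂ)ˣ} (hw : ∀ k x, w k x ∈ complexifiedGroup G) (hα₀ : 0 < α₀) (hξ : 0 < cs.ξ)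
    (hL : 1 ≤ cs.L)
    (h338 : ∀ k, 1 ≤ k → k ≤ cs.j → ∀ p ∈ X₂.plaqs,
      plaq (bg.Un k (1 : PBond P i → (Matrix n n ℂ)ˣ)) p = plaq (gaugeU (w k) (1 : PBond P i → (Matrix n n ℂ)ˣ)) p)
    (hJn : ∀ k, 1 ≤ k → k ≤ cs.j → ∀ b ∈ X₂.bonds,
      bg.Jn k (1 : PBond P i → (Matrix n n ℂ)ˣ) b =
        current (proj G hG) (cs.L ^ k)⁻¹ (gaugeU (w k) (1 : PBond P i → (Matrix n n ℂ)ˣ)) b) :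
    CondIV bg X₂ cs α₀ (1 : PBond P i → (Matrix n n ℂ)ˣ) :=
  condIV_one_of_eq338 (proj G hG) hα₀ hξ hL h338 hJn (fun k x X => proj_R G hG (hw k x) X)

/-- **LEMMA 4 FOR THE PRINTED PAIR `(𝐔, J(𝐔))` WITH (iv) DERIVED FROM (3.38), printed `π`, every closed `G ≤ U(N)`**: p07's
`B12Lemma4CondIV.ofBackground_mem_space'_lemma4_of_eq338` on `closedSubgroupModel G`, with `heGc`/`hπ`/`hgc` DISCHARGED (§6) and the
all-units rotation hypothesis `hπR` REPLACED by «`u_j` and `w₁` are `Gᶜ`-valued» (print: (3.37) `u_j` is a `Gᶜ`-valued gauge transformation).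
[cite: Balaban1987RG1, Lemma 4 (3.53) p.280 with (3.38) p.278 and (1.8) p.261] -/
theorem ofBackground_mem_space'_lemma4_of_eq338_closed (c : B12Sec2to5.Lemma4Consts) (hR : B12Sec2to5.Lemma4Restrictions c)
    (hB : 1 ≤ c.B₃) (hY : 1 ≤ c.B₃ ^ 2 * c.O₁ * c.M) (hα₁ : 16 * (c.O₁ * c.M * c.α₁) ≤ c.β) (hL10 : 1 + 10 * c.β ≤ c.L ^ 2)
    {F : Frame P i (Matrix n n ℂ)} {cs : StepConsts} (hξ : 0 < cs.ξ) (hξ1 : cs.ξ ≤ 1) (hcB : 0 < cs.cB)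
    (hL : 1 ≤ cs.L) (hLξ : cs.L ^ cs.j * cs.ξ = 1)
    {η τ m B₃'' : ℝ} {j : ℕ} (hη : 0 ≤ η) (hj : 1 ≤ j) (hscale : c.L ^ j * η ≤ 1)
    (hξx : cs.ξ * (c.L ^ (j - 1) * η) = c.L⁻¹ * η) (hτ0 : 0 ≤ τ) (hτ1 : τ ≤ 1) (hm : m < c.α₃)
    (hres'' : B₃'' * c.α₃ ≤ c.β * c.L⁻¹ ^ 2 * c.α₀)
    {Y : Region P i} (hXb : F.X.bonds ⊆ Y.bonds) (hXd : F.X.dpairs ⊆ Y.dpairs) (hX₂b : F.X₂.bonds ⊆ Y.bonds)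
    (hX₂p : F.X₂.plaqs ⊆ F.X.plaqs)
    (hXp : ∀ p ∈ F.X.plaqs, (⟨p.src, p.μ⟩ : PBond P i) ∈ Y.bonds ∧ (⟨p.src.shift p.μ, p.ν⟩ : PBond P i) ∈ Y.bonds ∧
      (⟨p.src.shift p.ν, p.μ⟩ : PBond P i) ∈ Y.bonds ∧ (⟨p.src, p.ν⟩ : PBond P i) ∈ Y.bonds ∧
      (p.src, p.μ, p.ν) ∈ Y.dpairs ∧ (p.src, p.ν, p.μ) ∈ Y.dpairs)
    {H K A : PBond P i → Matrix n n ℂ} {ℓ : Plaq P i → Matrix n n ℂ} (hKgc : ∀ b, K b ∈ lieC G hG) (hAgc : ∀ b, A b ∈ lieC G hG)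
    (h41 : ∀ p ∈ F.X.plaqs, ‖((plaq (fun b => expI cs.ξ (H b)) p : (Matrix n n ℂ)ˣ) : Matrix n n ℂ) - 1‖ <
      Real.exp (c.B₃ ^ 2 * c.O₁ * c.M * c.α₀) * Real.exp (c.B₃ * c.O₁ * c.M * c.α₀) *
      Real.exp (c.B₃ * c.O₁ * c.M * c.α₀) * Real.exp (c.O₁ * c.M * c.α₁) *
      ((1 + 2 * c.β) * c.α₀ * (c.L⁻¹ * η) ^ 2))
    (hH : ∀ b ∈ Y.bonds, ‖H b‖ < c.B₃ ^ 2 * c.O₁ * c.M * c.α₀ * (c.L ^ (j - 1) * η))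
    (h45 : ∀ p ∈ F.X.plaqs, ‖(cs.ξ : ℂ)⁻¹ • (H ⟨p.src, p.μ⟩ + H ⟨p.src.shift p.μ, p.ν⟩ - H ⟨p.src.shift p.ν, p.μ⟩ -
      H ⟨p.src, p.ν⟩) - ℓ p‖ < c.B₃ * (c.B₃ * c.O₁ * c.M * c.α₀ * (c.L ^ (j - 1) * η)) ^ 2)
    (hK : ∀ b ∈ Y.bonds, ‖K b‖ < c.B₃ ^ 2 * c.O₁ * c.M * c.α₀ * (c.L ^ (j - 1) * η))
    (hK1 : ∀ q ∈ Y.dpairs, ‖grad cs.ξ q.2.1 (fun y => K ⟨y, q.2.2⟩) q.1‖ < c.B₃ ^ 2 * c.O₁ * c.M * c.α₀ * (c.L ^ (j - 1) * η))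
    (h45τ : ∀ p ∈ F.X.plaqs, ‖(cs.ξ : ℂ)⁻¹ • (K ⟨p.src, p.μ⟩ + K ⟨p.src.shift p.μ, p.ν⟩ - K ⟨p.src.shift p.ν, p.μ⟩ -
      K ⟨p.src, p.ν⟩) - (τ : ℂ) • ℓ p‖ < c.B₃ * (c.B₃ * c.O₁ * c.M * c.α₀ * (c.L ^ (j - 1) * η)) ^ 2)
    (hA : ∀ b ∈ Y.bonds, ‖A b‖ ≤ c.B₃ * m)
    (hdA : ∀ q ∈ Y.dpairs, ‖grad cs.ξ q.2.1 (fun y => A ⟨y, q.2.2⟩) q.1‖ ≤ c.B₃ * m)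
    (hJY : ∀ b ∈ Y.bonds, ‖current (proj G hG) cs.ξ (fun b => expI cs.ξ (K b + A b)) b‖ <
      (1 + 3 * c.β) * c.α₀ * (c.L ^ (j - 1) * η) ^ 3 + 3 * c.β * c.α₀ * (c.L ^ (j - 1) * η) ^ 2 + B₃'' * c.α₃ +
        c.β * c.L⁻¹ ^ 2 * c.α₀)
    {uj : Site P i → (Matrix n n ℂ)ˣ} {ubar w₁ : ℕ → Site P i → (Matrix n n ℂ)ˣ} {ctr : ℕ → Site P i → Site P i}
    (hujGc : ∀ y, uj y ∈ complexifiedGroup G) (hw₁Gc : ∀ k x, w₁ k x ∈ complexifiedGroup G)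
    (huj : ∀ y, ‖(uj y : Matrix n n ℂ)‖ * ‖(↑(uj y)⁻¹ : Matrix n n ℂ)‖ ≤ Real.exp (c.B₃ ^ 2 * c.O₁ * c.M * c.α₀))
    (hubar : ∀ k x, ubar k x = uj (ctr k x))
    (h338 : ∀ k, 1 ≤ k → k ≤ cs.j → ∀ p ∈ F.X₂.plaqs, plaq (F.bg.Un k (fun b => expI cs.ξ (K b + A b))) p =
      plaq (gaugeU (uj * (ubar k)⁻¹) (fun b => expI cs.ξ (K b + A b))) p)
    (hJn : ∀ k, 1 ≤ k → k ≤ cs.j → ∀ b ∈ F.X₂.bonds, F.bg.Jn k (fun b => expI cs.ξ (K b + A b)) b =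
      current (proj G hG) (cs.L ^ k)⁻¹ (gaugeU (uj * (ubar k)⁻¹) (fun b => expI cs.ξ (K b + A b))) b)
    (h338₁ : ∀ k, 1 ≤ k → k ≤ cs.j → ∀ p ∈ F.X₂.plaqs,
      plaq (F.bg.Un k (1 : PBond P i → (Matrix n n ℂ)ˣ)) p = plaq (gaugeU (w₁ k) (1 : PBond P i → (Matrix n n ℂ)ˣ)) p)
    (hJn₁ : ∀ k, 1 ≤ k → k ≤ cs.j → ∀ b ∈ F.X₂.bonds,
      F.bg.Jn k (1 : PBond P i → (Matrix n n ℂ)ˣ) b =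
        current (proj G hG) (cs.L ^ k)⁻¹ (gaugeU (w₁ k) (1 : PBond P i → (Matrix n n ℂ)ˣ)) b) :
    ofBackground (proj G hG) cs.ξ (fun b => expI cs.ξ (K b + A b)) ∈ space' (closedSubgroupModel G hG) F cs c.α₀ c.α₁ := by
  have hα₀ : 0 < c.α₀ := by
    have hR' := hR
    unfold B12Sec2to5.Lemma4Restrictions at hR'
    exact hR'.1
  refine B12Lemma4Space.ofBackground_mem_space'_lemma4 (closedSubgroupModel G hG) c hR hB hY hα₁ hξ hξ1 hcB hη hj hscale hξx
    hτ0 hτ1 hm (closedSubgroupModel_heGc G hG cs.ξ) (proj G hG) (closedSubgroupModel_hπ G hG) (closedSubgroupModel_hgc_Gc G hG)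
    hXb hXd hXp hKgc hAgc h41 hH h45 hK hK1 h45τ hA hdA
    (fun b hb => B12CondIIIJ.condIII_second_of_restrictions c hR hη hj hscale hres'' (hJY b (hXb hb))) ?_ ?_
  · exact condIV_lemma4_of_eq338_closed G hG c hR hB hY hα₁ hL10 hξ hξ1 hL hLξ hη hj hscale hξx hτ0 hτ1 hm hres'' hX₂p hXp h41
      hH h45 hK h45τ hA hdA (fun b hb => hJY b (hX₂b hb)) hujGc huj hubar h338 hJn
  · exact condIV_one_of_eq338_closed G hG hw₁Gc hα₀ hξ hL h338₁ hJn₁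

/-- **LEMMA 4 FOR THE PRINTED PAIR WITH (iv) FROM (3.38) AND THE J-HALF OF (iii) DERIVED, printed `π` (`Cπ = √N`), every closed
`G ≤ U(N)`**: p07's `B12CondIIIJConcrete.ofBackground_mem_space'_lemma4_of_jInputs` on `closedSubgroupModel G` with `heGc`/`hπ`/`hgc`/`hπn`
DISCHARGED (§4, §6) and `hπR` REPLACED by «`u_j`, `w₁` `Gᶜ`-valued»; the one `π`-dependent restriction reads
`4(d−1)·√N·C_F(1)·(B₃²O₁M)²·α₀ ≤ β`. [cite: Balaban1987RG1, Lemma 4 (3.53) p.280 with p.279 after (3.47) and (3.38) p.278] -/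
theorem ofBackground_mem_space'_lemma4_of_jInputs_closed [Nonempty n] (c : B12Sec2to5.Lemma4Consts)
    (hR : B12Sec2to5.Lemma4Restrictions c)
    (hB : 1 ≤ c.B₃) (hY : 1 ≤ c.B₃ ^ 2 * c.O₁ * c.M) (hα₁ : 16 * (c.O₁ * c.M * c.α₁) ≤ c.β) (hL10 : 1 + 10 * c.β ≤ c.L ^ 2)
    {F : Frame P i (Matrix n n ℂ)} {cs : StepConsts} (hξ : 0 < cs.ξ) (hξ1 : cs.ξ ≤ 1) (hcB : 0 < cs.cB)
    (hL : 1 ≤ cs.L) (hLξ : cs.L ^ cs.j * cs.ξ = 1)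
    {η τ m B₃'' : ℝ} {j : ℕ} (hη : 0 ≤ η) (hj : 1 ≤ j) (hscale : c.L ^ j * η ≤ 1)
    (hξx : cs.ξ * (c.L ^ (j - 1) * η) = c.L⁻¹ * η) (hτ0 : 0 ≤ τ) (hτ1 : τ ≤ 1) (hm : m < c.α₃) (hB'' : 0 ≤ B₃'')
    (hres'' : B₃'' * c.α₃ ≤ c.β * c.L⁻¹ ^ 2 * c.α₀)
    (hresJ : 4 * ((P.d - 1) * (Real.sqrt (Fintype.card n) * C311 1)) * (c.B₃ ^ 2 * c.O₁ * c.M) ^ 2 * c.α₀ ≤ c.β)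
    {Y : Region P i} (hXb : F.X.bonds ⊆ Y.bonds) (hXd : F.X.dpairs ⊆ Y.dpairs) (hX₂b : F.X₂.bonds ⊆ Y.bonds)
    (hX₂p : F.X₂.plaqs ⊆ F.X.plaqs)
    (hXp : ∀ p ∈ F.X.plaqs, (⟨p.src, p.μ⟩ : PBond P i) ∈ Y.bonds ∧ (⟨p.src.shift p.μ, p.ν⟩ : PBond P i) ∈ Y.bonds ∧
      (⟨p.src.shift p.ν, p.μ⟩ : PBond P i) ∈ Y.bonds ∧ (⟨p.src, p.ν⟩ : PBond P i) ∈ Y.bonds ∧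
      (p.src, p.μ, p.ν) ∈ Y.dpairs ∧ (p.src, p.ν, p.μ) ∈ Y.dpairs)
    {H H₁ K A : PBond P i → Matrix n n ℂ} {ℓ : Plaq P i → Matrix n n ℂ} (hKgc : ∀ b, K b ∈ lieC G hG)
    (hAgc : ∀ b, A b ∈ lieC G hG)
    (h41 : ∀ p ∈ F.X.plaqs, ‖((plaq (fun b => expI cs.ξ (H b)) p : (Matrix n n ℂ)ˣ) : Matrix n n ℂ) - 1‖ <
      Real.exp (c.B₃ ^ 2 * c.O₁ * c.M * c.α₀) * Real.exp (c.B₃ * c.O₁ * c.M * c.α₀) *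
      Real.exp (c.B₃ * c.O₁ * c.M * c.α₀) * Real.exp (c.O₁ * c.M * c.α₁) *
      ((1 + 2 * c.β) * c.α₀ * (c.L⁻¹ * η) ^ 2))
    (hH : ∀ b, ‖H b‖ < c.B₃ ^ 2 * c.O₁ * c.M * c.α₀ * (c.L ^ (j - 1) * η))
    (hHd : ∀ μ ν y, ‖grad cs.ξ μ (fun z => H ⟨z, ν⟩) y‖ < c.B₃ ^ 2 * c.O₁ * c.M * c.α₀ * (c.L ^ (j - 1) * η))
    (h45 : ∀ p ∈ F.X.plaqs, ‖(cs.ξ : ℂ)⁻¹ • (H ⟨p.src, p.μ⟩ + H ⟨p.src.shift p.μ, p.ν⟩ - H ⟨p.src.shift p.ν, p.μ⟩ -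
      H ⟨p.src, p.ν⟩) - ℓ p‖ < c.B₃ * (c.B₃ * c.O₁ * c.M * c.α₀ * (c.L ^ (j - 1) * η)) ^ 2)
    (hK : ∀ b, ‖K b‖ < c.B₃ ^ 2 * c.O₁ * c.M * c.α₀ * (c.L ^ (j - 1) * η))
    (hKd : ∀ μ ν y, ‖grad cs.ξ μ (fun z => K ⟨z, ν⟩) y‖ < c.B₃ ^ 2 * c.O₁ * c.M * c.α₀ * (c.L ^ (j - 1) * η))
    (h45τ : ∀ p ∈ F.X.plaqs, ‖(cs.ξ : ℂ)⁻¹ • (K ⟨p.src, p.μ⟩ + K ⟨p.src.shift p.μ, p.ν⟩ - K ⟨p.src.shift p.ν, p.μ⟩ -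
      K ⟨p.src, p.ν⟩) - (τ : ℂ) • ℓ p‖ < c.B₃ * (c.B₃ * c.O₁ * c.M * c.α₀ * (c.L ^ (j - 1) * η)) ^ 2)
    (hA : ∀ b, ‖A b‖ ≤ c.B₃ * m) (hAd : ∀ μ ν y, ‖grad cs.ξ μ (fun z => A ⟨z, ν⟩) y‖ ≤ c.B₃ * m)
    (h42 : ∀ b ∈ Y.bonds, ‖current (proj G hG) cs.ξ (fun b => expI cs.ξ (H b)) b‖ < (1 + 3 * c.β) * c.α₀ * (c.L ^ (j - 1) * η) ^ 3)
    (hS : ∀ b ∈ Y.bonds,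
      ‖lapCur (proj G hG) cs.ξ (1 : PBond P i → (Matrix n n ℂ)ˣ) (H - H₁) b‖ < c.β * c.α₀ * (c.L ^ (j - 1) * η) ^ 2)
    (hSτ : ∀ b ∈ Y.bonds,
      ‖lapCur (proj G hG) cs.ξ (1 : PBond P i → (Matrix n n ℂ)ˣ) (K - (τ : ℂ) • H₁) b‖ < c.β * c.α₀ * (c.L ^ (j - 1) * η) ^ 2)
    (hA2 : ∀ b ∈ Y.bonds, ‖lapCur (proj G hG) cs.ξ (1 : PBond P i → (Matrix n n ℂ)ˣ) A b‖ ≤ B₃'' * m)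
    {uj : Site P i → (Matrix n n ℂ)ˣ} {ubar w₁ : ℕ → Site P i → (Matrix n n ℂ)ˣ} {ctr : ℕ → Site P i → Site P i}
    (hujGc : ∀ y, uj y ∈ complexifiedGroup G) (hw₁Gc : ∀ k x, w₁ k x ∈ complexifiedGroup G)
    (huj : ∀ y, ‖(uj y : Matrix n n ℂ)‖ * ‖(↑(uj y)⁻¹ : Matrix n n ℂ)‖ ≤ Real.exp (c.B₃ ^ 2 * c.O₁ * c.M * c.α₀))
    (hubar : ∀ k x, ubar k x = uj (ctr k x))
    (h338 : ∀ k, 1 ≤ k → k ≤ cs.j → ∀ p ∈ F.X₂.plaqs, plaq (F.bg.Un k (fun b => expI cs.ξ (K b + A b))) p =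
      plaq (gaugeU (uj * (ubar k)⁻¹) (fun b => expI cs.ξ (K b + A b))) p)
    (hJn : ∀ k, 1 ≤ k → k ≤ cs.j → ∀ b ∈ F.X₂.bonds, F.bg.Jn k (fun b => expI cs.ξ (K b + A b)) b =
      current (proj G hG) (cs.L ^ k)⁻¹ (gaugeU (uj * (ubar k)⁻¹) (fun b => expI cs.ξ (K b + A b))) b)
    (h338₁ : ∀ k, 1 ≤ k → k ≤ cs.j → ∀ p ∈ F.X₂.plaqs,
      plaq (F.bg.Un k (1 : PBond P i → (Matrix n n ℂ)ˣ)) p = plaq (gaugeU (w₁ k) (1 : PBond P i → (Matrix n n ℂ)ˣ)) p)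
    (hJn₁ : ∀ k, 1 ≤ k → k ≤ cs.j → ∀ b ∈ F.X₂.bonds,
      F.bg.Jn k (1 : PBond P i → (Matrix n n ℂ)ˣ) b =
        current (proj G hG) (cs.L ^ k)⁻¹ (gaugeU (w₁ k) (1 : PBond P i → (Matrix n n ℂ)ˣ)) b) :
    ofBackground (proj G hG) cs.ξ (fun b => expI cs.ξ (K b + A b)) ∈ space' (closedSubgroupModel G hG) F cs c.α₀ c.α₁ :=
  ofBackground_mem_space'_lemma4_of_eq338_closed G hG c hR hB hY hα₁ hL10 hξ hξ1 hcB hL hLξ hη hj hscale hξx hτ0 hτ1 hm hres''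
    hXb hXd hX₂b hX₂p hXp hKgc hAgc h41 (fun b _ => hH b) h45 (fun b _ => hK b) (fun q _ => hKd q.2.1 q.2.2 q.1) h45τ
    (fun b _ => hA b) (fun q _ => hAd q.2.1 q.2.2 q.1)
    (fun b hb => norm_current_lt_jBudget c hR hB hY hresJ hξ hξ1
      (B12CondIIIJ.scale_nonneg j (by unfold B12Sec2to5.Lemma4Restrictions at hR; linarith [hR.2.2.2.2.2.2.2.1]) hη)
      (B12CondIIIJ.scale_le (by unfold B12Sec2to5.Lemma4Restrictions at hR; linarith [hR.2.2.2.2.2.2.2.1]) hη hj hscale)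
      hτ0 hτ1 hm hB'' (Real.sqrt_nonneg _) (norm_proj_le G hG) (fun b => (hH b).le) (fun μ ν y => (hHd μ ν y).le)
      (fun b => (hK b).le) (fun μ ν y => (hKd μ ν y).le) hA hAd b (h42 b hb) (hS b hb) (hSτ b hb) (hA2 b hb))
    hujGc hw₁Gc huj hubar h338 hJn h338₁ hJn₁


/-- **`(𝐔^u, J(𝐔^u)) ∈ U^c_j ↔ (𝐔, J(𝐔)) ∈ U^c_j` with the printed `π`, every closed `G ≤ U(N)` and every `Gᶜ`-valued `u`**:
membership of the printed pair is decided on the `Gᶜ`-orbit ((1.9) intertwines (1.10), `ofBackground_gaugeU_closed`, and the spaces are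
unions of `Gᶜ`-orbits, `B12RegularSpaces111.act_mem_space_iff`) — the orbit statement behind p. 277 «the orbit of the configuration
U_j(□₀, …) above contains the configuration exp iξ𝐇_j(…)». [cite: Balaban1987RG1, (1.19) p.263, (1.10) p.262] -/
theorem ofBackground_gaugeU_mem_space_iff_closed {F : Frame P i (Matrix n n ℂ)} {cs : StepConsts} {α₀ α₁ γ₀ : ℝ} (ξ : ℝ)
    {u : Site P i → (Matrix n n ℂ)ˣ} (hu : ∀ x, u x ∈ complexifiedGroup G) (U : PBond P i → (Matrix n n ℂ)ˣ) :
    ofBackground (proj G hG) ξ (gaugeU u U) ∈ space (closedSubgroupModel G hG) F cs α₀ α₁ γ₀ ↔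
      ofBackground (proj G hG) ξ U ∈ space (closedSubgroupModel G hG) F cs α₀ α₁ γ₀ := by
  rw [ofBackground_gaugeU_closed G hG ξ hu U]
  exact act_mem_space_iff _ hu

end CondIVClosed

/-! ## §8. [15] (3.117) «D*J = 0» for the (1.8) current WITH the printed `π`, every closed `G ≤ U(N)`, every `Gᶜ`-valued `𝐔` -/

section Conservation

open Literature.MathematicalPhysics.QuantumFieldTheory.Balaban1983to89.B12RegularSpaces111 (plaq)
open Literature.MathematicalPhysics.QuantumFieldTheory.Balaban1983to89.B9Eq39Adjoint (R divB divP plaqU R_smul R_neg)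
open Literature.MathematicalPhysics.QuantumFieldTheory.Balaban1983to89.B9Eq37Insertion (imC)
open Literature.MathematicalPhysics.QuantumFieldTheory.Balaban1983to89.B9Eq3117Current (divB_smul divB_divP_eq_zero imC_plaqU_swap
  R_imC_self)
open Literature.MathematicalPhysics.QuantumFieldTheory.Balaban1983to89.B9TorusCalculus (torusT torusT_comm)
open Literature.MathematicalPhysics.QuantumFieldTheory.Balaban1983to89.B12Eq18Current (dirForm imPlaq current current_apply)

variable [Fintype n] [DecidableEq n] (G : Subgroup (UN n)) (hG : IsClosed (G : Set (UN n)))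
variable {P : Params} {i : ℕ}

/-- Plaquette variables of a `Gᶜ`-valued configuration are `Gᶜ`-valued. [cite: Balaban1987RG1, (1.10) p.262] -/
theorem plaqU_dirForm_mem_complexifiedGroup {U : PBond P i → (Matrix n n ℂ)ˣ} (hU : ∀ b, U b ∈ complexifiedGroup G)
    (μ ν : Fin P.d) (z : Site P i) : plaqU (torusT P i) (dirForm U) μ ν z ∈ complexifiedGroup G := by
  unfold plaqU dirForm
  exact (complexifiedGroup G).mul_mem ((complexifiedGroup G).mul_mem ((complexifiedGroup G).mul_mem (hU _) (hU _))
    ((complexifiedGroup G).inv_mem (hU _))) ((complexifiedGroup G).inv_mem (hU _))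

/-- The plaquette function `ξ⁻²π Im ∂𝐔` of (1.8) is antisymmetric in the two directions. [cite: Balaban1987RG1, (1.8) p.261] -/
theorem imPlaq_swap (π : Matrix n n ℂ →ₗ[ℂ] Matrix n n ℂ) (ξ : ℝ) (U : PBond P i → (Matrix n n ℂ)ˣ) (μ ν : Fin P.d)
    (z : Site P i) : imPlaq π ξ U ν μ z = -imPlaq π ξ U μ ν z := by
  simp only [imPlaq]
  rw [imC_plaqU_swap, map_neg, smul_neg]

/-- `Ad` of the plaquette variable fixes `ξ⁻²π Im ∂𝐔(p)` for the printed `π` and `Gᶜ`-valued `𝐔` (`π` commutes with `Ad(∂𝐔(p))` by §3,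
and `Ad(W)` fixes `Im W`). [cite: Balaban1987RG1, (1.8) p.261, (1.10) p.262] -/
theorem R_plaqU_imPlaq (ξ : ℝ) {U : PBond P i → (Matrix n n ℂ)ˣ} (hU : ∀ b, U b ∈ complexifiedGroup G) (μ ν : Fin P.d)
    (z : Site P i) :
    R (plaqU (torusT P i) (dirForm U) μ ν z) (imPlaq (proj G hG) ξ U ν μ z) = imPlaq (proj G hG) ξ U ν μ z := by
  rw [imPlaq_swap]
  simp only [imPlaq]
  rw [R_neg, R_smul, ← proj_R G hG (plaqU_dirForm_mem_complexifiedGroup G hU μ ν z), R_imC_self]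

/-- **[15] (3.117) «D*J = 0» FOR THE (1.8) CURRENT WITH THE PRINTED `π`**, every closed `G ≤ U(N)` and every `Gᶜ`-valued `𝐔` on the
torus of record: the covariant divergence of `J(𝐔) = D^{ξ*}_𝐔 ξ⁻²π Im ∂𝐔` vanishes (p07's `B12Eq18Current` «NOT here: D^{ξ*}J = 0 with π»;
the `π = id` case is `B9TorusCalculus.divB_J_eq_zero`) — `B9Eq3117Current.divB_divP_eq_zero` with its `Ad(∂𝐔(p))`-invariance hypothesis
supplied by §3 `proj_R`. [cite: Balaban1985BackgroundPropagators, (3.117) p.419; Balaban1987RG1, (1.8) p.261] -/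
theorem divB_current_eq_zero_closed (ξ : ℝ) {U : PBond P i → (Matrix n n ℂ)ˣ} (hU : ∀ b, U b ∈ complexifiedGroup G)
    (x : Site P i) :
    divB (torusT P i) (dirForm U) (fun μ y => current (proj G hG) ξ U ⟨y, μ⟩) x = 0 := by
  have hJ : (fun μ y => current (proj G hG) ξ U ⟨y, μ⟩) =
      fun μ y => ((ξ : ℂ)⁻¹) • divP (torusT P i) (dirForm U) (imPlaq (proj G hG) ξ U) μ y := rfl
  rw [hJ, divB_smul, divB_divP_eq_zero (torusT P i) (dirForm U) torusT_comm (imPlaq (proj G hG) ξ U)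
    (fun μ ν y => imPlaq_swap (proj G hG) ξ U μ ν y) (fun μ ν z => R_plaqU_imPlaq G hG ξ hU μ ν z), smul_zero]

end Conservation

end Literature.MathematicalPhysics.QuantumFieldTheory.Balaban1983to89.B12Eq18Projection
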